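import Summits.HodgeConjecture.HodgeConjecture.Theorems.HCCMUnconditionalOfGenericFloorV7
import Summits.HodgeConjecture.CorCM.Hyp413.A3Liu413FaceTypes
import Summits.HodgeConjecture.HodgeConjecture.Theorems.H413CohFormsCarriers
import Literature.NumberTheory.Li1992.RallisInnerProductThetaLift
import Literature.NumberTheory.Li1992.RallisKernelIdentity
import Summits.HodgeConjecture.HodgeConjecture.Theorems.H413CuspCotPin
import Summits.HodgeConjecture.HodgeConjecture.Theorems.P4StubT2cCohClassMapOfHol
import Summits.HodgeConjecture.HodgeConjecture.Theorems.H413TowerConjPin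
import Summits.HodgeConjecture.HodgeConjecture.Theorems.H413AdmissibleLineSign
import Summits.HodgeConjecture.HodgeConjecture.Theorems.H413LineTransportAllFrames
import Summits.HodgeConjecture.HodgeConjecture.Theorems.H413ConjugatePartnerAtHolds
import Summits.HodgeConjecture.HodgeConjecture.Theorems.F0FloorSockets
import Summits.HodgeConjecture.HodgeConjecture.Theorems.H413E2RallisRankOneOfKernel
import Summits.HodgeConjecture.HodgeConjecture.Theorems.H413E2SWKernelRallisOfSiegelWeil
import Summits.HodgeConjecture.HodgeConjecture.Theorems.H413E2SWSiegelWeilCMClosed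
import Summits.HodgeConjecture.HodgeConjecture.Theorems.H413HolThetaAtAdmissibleLineFold
import Summits.HodgeConjecture.HodgeConjecture.Theorems.H413ChiNRowAtPin
import Mathlib.RepresentationTheory.Intertwining
import HarnessLib

-- ED. 2.1 registrar pass (A-plan1 (g18), 2026-08-31T00:1xZ; director s355 cure): the one `[cite: …]` tag inside the socket-`def`
-- docstring of `pinRep` is rewritten as prose `(print: …)`; theorem tags kept; declarations byte-identical to F0P4-plan (g3) bytes f2ef4e9497a1ae8d.

-- ED. 2 registrar cures (A-plan1 (g17), 2026-08-30T22:50Z; declarations byte-identical to F0P4-plan (g2)'s ed. 2 rf 0f6e3f667da7c587):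
-- (s355) `[cite: …]` tags inside Prop-socket `def` docstrings rewritten as prose `(print: …)`; (lit1 D-CITE 22:34:57Z) bib key
-- `Deligne1971HodgeII` → `DeligneHodgeII1971`.
-- ED. 2.1 (F0P4-plan (g3), 2026-08-31; BY-NAME FOLD, director s347 pattern): `stub_T3a_lineTransportAt` CLOSED by ★ `Theorems/H413LineTransportAllFrames.lean` ::
-- `Summit.HodgeConjecture.HodgeConjecture.Cruxes.H413.LineTransport.lineTransportAt` (A-p17 (g13); type = the stub's body verbatim; proof over ★ p795659 master
-- (F0P4-p06) and ★ p795769 (C4) reindex (F0P4-p04); companion pin ★ p796078 (F0P4-p06)). Every `def` byte-identical to ED. 2 (eadc3e68a98dec9a); open stubs = THREE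
-- (`stub_rallisInnerProductFormula` XL = ENGINE E-2, `stub_T3a_holThetaAtAdmissibleLineOfRallisAt` L, `stub_T3b_conjugatePartnerAt` M).
-- ED. 3 (F0P4-plan (g3), 2026-08-31; director s393 E2-1 «rank-one slice is the letter of record» + F0P4-ref1 r12 n3), on top of tree ED. 2.1 07742b229d434d76:
-- the antecedent∕stub token `Li1992.RallisInnerProductFormulaUnitaryDualPair` ↦ `Li1992.RallisInnerProductFormulaUnitaryDualPairRankOne` (★ p797030
-- `Li1992/RallisKernelIdentity` :143 = p789496 :251–293 at `M := 1`, range `2 < N`, + four structure binders J-E2-1 (β)) in EXACTLY {S6 `stub_rallisInnerProductFormula`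
-- type, `def StubT3aHolThetaRealisationOfRallisAt`, `def StubT3aHolThetaAtAdmissibleLineOfRallisAt`, the glue signatures `stubT3a_of` ∕ `H413_of_P4` ∕ the `hocc`-heads ∕
-- `H413_of_P4_ed2`} and NOTHING else — a WEAKENING of an assumption (the line now rests on [Li1992, Thm 2.1] for OUR pair only: `dim W = 1`, `N > 2`); S6 closes
-- as `E2RallisInnerProduct.rallisRankOne_holds` (tree `Cruxes/H413/Lines/F0_E2RallisInnerProduct.lean`, ED. 1 b0273c1a2aff) when ENGINE E-2's head is sorry-free;
-- the general statement still implies the new letter (★ `Li1992.rallisRankOne_of_general`).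
-- ED. 3.1 (F0P4-plan (g3), 2026-08-31; ruling (A″) on F0P4-p02 (g2)), on top of tree ED. 3 a8bafe33ee2e: the same 8 tokens `…UnitaryDualPairRankOne` ↦
-- `…UnitaryDualPairRankOneCont` (★ `Li1992/RallisKernelIdentity` ED. 2 §4: + the coefficient-continuity binder; bridges `rankOneCont_of_rankOne`, `rankOneCont_of_general`) and
-- NOTHING else — again a weakening of an assumption; S6 closes as `E2RallisInnerProduct.rallisRankOneCont_holds` (parent ED. 1.1: closed modulo the E2-SW child).
-- ED. 3.1′ = R3 SOCKET HEAD (F0P4-plan (g3), 2026-08-31; A-plan1 (g18) 01:05:17Z R3 prep, director s412∕s413): + `import …Theorems.F0FloorSockets` (★ p796699, the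
-- Theses-free socket module) and TWO heads at the END of the file — `hocc_of_F0 : …Theorems.F0FloorSockets.HoccType := hocc_of_stubs` (the socket III-2 (c)′ BY THE SOCKET
-- NAME, from the registered stubs only; kernel-defeq to the in-file `HoccType` by delta — both are the `hocc` binder of ★ `hc_cm_of_generic_floor_v7` verbatim) and
-- `hocc_of_F0_shapes : T2a → T2b → T2c → S6 → T3a-LT → T3a″ → T3b → …F0FloorSockets.HoccType` (stub STATEMENTS as hypotheses); 0 statement ∕ 0 stub ∕ 0 other head changed.
-- ED. 3.2 (F0P4-plan (g3), 2026-08-31; BY-NAME FOLD, director s347 pattern): `stub_T3b_conjugatePartnerAt` (S5) CLOSED by ★ p799706 `Theorems/H413ConjugatePartnerAtHolds.lean` ::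
-- `ConjugatePartner.stubT3bConjugatePartnerAt_holds` (F0P4-p05 (g0) over F0P4-p03 (g0) ★ p792056 p792581 p794420 p798585 + A-p17 ★ p796928); +1 import; open stubs → 2 {S6 `stub_rallisInnerProductFormula` = E-2, S4b}.
-- ED. 3.3 (F0P4-plan (g3), 2026-08-31; LETTER RULING «CM STRUCTURE BINDERS» 01:40:06Z, L4): the S6 letter and the antecedent of the two `…OfRallisAt`
-- statements become `Li1992.RallisInnerProductFormulaUnitaryDualPairRankOneContCM` (★ `Li1992/RallisKernelIdentity` ED. 3 §5: the ED. 2 §4 telescope +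
-- `[IsTotallyReal F] [IsTotallyComplex E] (τ : E →+* ℂ) (hτ : (JV.map τ).PosDef)`; bridge `rankOneContCM_of_rankOneCont`) — a WEAKENING of S6 (the only case the
-- pin instantiates: `F = L⁺`, `E = L` CM, `J_V = diagonal (frameD V)` definite at every `τ′ ≠ ι₁`), hence a weaker antecedent for S4b∕S4a′; the swap touches the
-- same signature lines as ED. 3.1 and NOTHING else; S6 closes as `E2RallisInnerProduct.rallisRankOneContCM_holds` (parent ED. 1.2).
-- ED. 3.3R (registrar A-plan1 (g18), commit c540e5119a09): ED. 3.3 over the ★ L1 ED. 4 letter; R3 #5 on socket item stmt-HodgeConjecture-27457 `F0Hocc` — open stubs {S6, S4b}.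
-- ED. 3.4 (F0P4-plan (g4) 2026-08-31; PLAN v4 §2 «S4b FOLD BY NAME»): `stub_T3a_holThetaAtAdmissibleLineOfRallisAt` becomes a THEOREM = ★ p803540 `ThetaJunction.holThetaAtAdmissibleLine_fold`
-- applied to ★ p810753 `RallisTransport.chiN_of_rankOneContCM` (F0P4-p05 (g2), over F0P4-p04 (g3) FILE 2 ★ p809868 + F0P4-p03 (g3) pin bricks); +2 imports; NO signature line changes;
-- open stubs → EXACTLY ONE {S6 `stub_rallisInnerProductFormula`}, which closes BY NAME in ED. 4 as `E2RallisRankOne.rallisRankOneContCM_of_kernelCM (E2SiegelWeil.kernelRallisIdentityCM_of_siegelWeil ‹SW2(iii) closer›)`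
-- (★ p810320 PORT-B ∘ ★ p810576 PORT-A, A-p17 (g14)). HC_CM is proved only modulo the printed citations until rung 0 closes.
-- ED. 4 (F0P4-plan (g4) 2026-08-31T06:59Z; recipe of record 04:17Z + ROAD (β) 04:44Z): S6 `stub_rallisInnerProductFormula` becomes a THEOREM :=
-- `E2RallisRankOne.rallisRankOneContCM_of_kernelCM (E2SiegelWeil.kernelRallisIdentityCM_of_siegelWeil E2SWSiegelWeilCM.siegelWeil_weilRange_CM)` (★ p810320 ∘ ★ p810576 ∘ ★ p814040);
-- +3 imports (Theorems only, never `Lines`); NO signature line changes; open stubs → ∅ (27457 re-check with `--crux-decl …Theorems.F0FloorSockets.HoccType` expects «stubs registered: ∅»);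
-- the socket item closes by the separate `Theorems/` file `F0Hocc_holds : …Theses.HCCMUnconditional.F0Hocc := HoccOfRallis.hocc_of_rankOneContCM (…same term…)` (★ p811142, A-p17 (g14), `--workitem stmt-HodgeConjecture-27457`).

/-!
# FLOOR-0 PROGRAMME P4 «admissible occurs in H¹» — LINE `F0-P4AdmissibleOccursInH1` (keyed F0P4 planner cut; ED. 2: 7 stubs, 4 open)

> **ED. 2 (F0P4-plan (g2) 2026-08-30; director s354 (4) «price ∕ register (LT)»; A-p17 (g12) `LT-census.A-p17g12.md`; F0P4-p01 SEAT-(i) MEMO v2; F0P4-p02 SEAT-(ii) MEMO v1).**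
> T3a′ (`stub_T3a_holThetaRealisationOfRallisAt`) is now a THEOREM (`stubT3aOfRallis_of`: the ADMISSIBLE LINE of ★ p791505 `AdmissibleLine.exists_admissibleLine`, transport,
> composition — kernel-checked, ≈ 30 lines) of TWO NEW REGISTERED STUBS: **`stub_T3a_lineTransportAt : StubT3aLineTransportAt`** (T3a-LT, L: the finite-adélic LINE TRANSPORT
> `locF a = locF a′ ⇒ Ω(s_θ(a), χ) ≃ Ω(s_θ(a′), χ)` `U(V)(𝔸_f)`-equivariantly ON THE NOSE, GENERIC over a CM field, a rank-3 diagonal frame and a unitary splitting character `θ` —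
> the ONE non-generic input of the theta road (`η = 1`), shared with programme P2; road (G), A-p17) and **`stub_T3a_holThetaAtAdmissibleLineOfRallisAt :
> StubT3aHolThetaAtAdmissibleLineOfRallisAt`** (T3a″, L: DISJUNCT A of the node — `ι₁ ∈ Φ_μ`, decided by ★ `IndexOrientation.embedding_mk_eq_of_indexOfRecord` — realised AT THE
> ADMISSIBLE LINE `a_e` of each triple, given Rallis, LT-free: junction + descent + holomorphy + non-vanishing ∕ occupancy; F0P4-p01 (J), p02 ((χ) + assembly), p05 (J-R), p07 (A),
> p08 (F4)).  Registered holes after ED. 2 = SEVEN `stub_*`, FOUR open: `stub_rallisInnerProductFormula` (XL), `stub_T3a_lineTransportAt` (L), `stub_T3a_holThetaAtAdmissibleLineOfRallisAt`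
> (L), `stub_T3b_conjugatePartnerAt` (M).  The node letters `StubT3aHolThetaRealisationAt` ∕ `StubT3aHolThetaRealisationOfRallisAt` and every head (`hocc_of_stubs`, `H413_of_P4`,
> `H413_of_hdictE_hJ3a`) are UNCHANGED (REF1 n1); new heads `admissible_occursInH1_holds_of7`, `H413_of_P4_ed2`; one new import (★ p791505 `Theorems/H413AdmissibleLineSign`).
> Every other byte of ed. 1.4 (53864cd9f6723383) kept.  HC_CM is proved only modulo the printed citations until rung 0 closes.
>
> **ED. 1.1 (director s341 2026-08-30T21:16:34Z «DECISION S4 non-vanishing: DEBT-FREE ROAD ∕ ONE CURRENCY WITH P2»).**  T3a is now a THEOREM (`stubT3a_of`, modus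
> ponens) of TWO stubs: the SHARED stub **`stub_rallisInnerProductFormula : Literature.NumberTheory.Li1992.RallisInnerProductFormulaUnitaryDualPair`** ([Li1992, Thm. 2.1] over the
> tree's CONSTRUCTED unitary dual pair — ★ p789496 `Literature/NumberTheory/Li1992/RallisInnerProductThetaLift.lean`, F0-typ3 (g0); the decl VERBATIM is the stub's type, so
> P2's «F0-P2CohSpectrumL2» and this line register ONE item) and **`stub_T3a_holThetaRealisationOfRallisAt`** (T3a′ = T3a's body under that hypothesis: junction +
> descent + local occupancy).  Rallis' formula is a stub to be PROVED, never a hypothesis of a closing file (D-0183 debt rule).  Every other byte of ed. 1 (98373f7d760ea57a) kept.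

Cell hodgecm-mathlib (D-0151; human ruling D-0183 ∕ director s317: FLOOR 0 = HC_CM on Mathlib alone; s320 (3) ∕ s335: this keyed planner
(`hodgecm-mathlib-F0P4-plan-g0`) produces the 5–7-stub LINE skeleton for P4; registration through the registrar chain, NO `ledger skeleton
check --crux` on 24833).  Crux item H413 = stmt-HodgeConjecture-24833 (route `HCCMUnconditional`).  TARGET = the `hocc` binder of
★ `Theorems/HCCMUnconditionalOfGenericFloorV7.lean` ll. 81–85 VERBATIM (`HoccType` below = the registered stub `stub_admissible_occursInH1` of
`Cruxes/H413/Lines/a3_liu413.lean` v10.2): at `n = 3`, for every `τ'` and every adèlic oscillator triple `t = (μ, ε, χ)` of the PIN's datum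
`datum413` with `μ` of weight one and `ε` `μ`-admissible, the constructed `ω_V(t)` OCCURS in the pin's `H¹_{B,τ'}(A_∞, ℂ)` (a non-zero
`ℂ[U(V)(𝔸_{F⁺,f})]`-intertwiner `ω_V(t) → H¹_B`).  HC_CM is proved only modulo the printed citations until rung 0 closes; this file proves NOTHING about them.

THIS FILE REFINES the P4 line of record `P4AdmissibleOccursInH1` v2.1 (A-p13 (g21), skeleton c5032e58 ∕ card 01eae432; its two nodes
`StubT2MatsushimaHodgeAt` (T2) and `StubT3ThetaFormsAt` (T3) are kept VERBATIM below and become THEOREMS of five finer stubs):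

* T2 = T2a + T2b + T2c.  **T2a `stub_T2a_holClassMapAt`** (M): the injective equivariant HOLOMORPHIC class map
  `holCotForms 𝔞₀ → H¹_{B,τ'}` WITH RANGE IN THE HODGE `(1,0)`-PART OF THE TOWER (the span of the `ofLevel`-images of level families all of whose
  components lie in `F¹H¹(X_Δ; ℂ)` — written inline over ★ `universeOf`/`towerLevel`/`ofLevel`, = `(pinD …).H10` componentwise by ★ `classMapDatumOf_H10`);
  this is exactly what A-p13's `H413CuspCotComponents`/`H413CuspCotTower`/`H413CuspCotTransport` (`compClass`, `towerFamily_mem`, `clsAt`,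
  `of_smul_clsAt`, `clsAt_eq_zero_iff`, `toRegimeFun_mem_cuspCotSat`) assemble.  **T2b `stub_T2b_towerConjugationAt`** (M): COMPLEX CONJUGATION on the
  pin's tower module — an injective conjugate-linear `cB : H¹_B → H¹_B` commuting with `rhoB` and with `H10T ∩ cB(H10T) = 0` (levelwise `conj ⊗ id` on
  `ℂ ⊗_ℚ H¹(X_Δ; ℚ)`, ★ `HodgeStructure.isCompl_F_complexConj` at weight `1`, compatible with the `ℚ`-rational transition/translation maps).
  **T2c `stub_T2c_cohClassMapOfHol`** (M⁻, GENERIC — no pin): from ANY injective equivariant `cls₁₀` on `holCotForms 𝔞₀` with range in a subspace `P`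
  and ANY injective equivariant conjugate-linear `cB` with `P ∩ cB P = 0`, an injective equivariant `cls` on `cohForms 𝔞₀ = hol ⊔ conj hol`
  (`cls (f + conj f') := cls₁₀ f + cB (cls₁₀ f')`; needs `hol ⊓ conj hol = ⊥` — `K_∞`-type rigidity of ★ `weightForms` for the cotangent cocycle — and
  the `rightRep`-stability of `holCotForms 𝔞₀`, A-p13's `ArchFactor.IsHonest.rightRep_mem_holCotForms` + `archFactorOf_isHonest`; Mathlib `LinearPMap.sup`).
* T3 = T3a + T3b (convention-free split of the theta road by Hodge type); ED. 1.1: T3a = T3n `stub_rallisInnerProductFormula` + T3a′ `stub_T3a_holThetaRealisationOfRallisAt`.  **T3a (node)** (L): at `n = 3`, ONE of the two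
  `ι₁`-classes of weight-one admissible triples (`ι₁ ∈ Φ_μ` or `ι₁ ∉ Φ_μ` — which one is fixed by the tree's sign conventions, so the stub asserts the
  DISJUNCTION) is realised, triple by triple, by NON-ZERO equivariant maps `ω_V(t) → holCotForms 𝔞₀` (the global theta lift of `χ` with the HARMONIC
  archimedean vector: [Liu2021, l. 2145; Lem. D.2], [KonnoKonno2007, Thm 5.4], [Weil1964, n° 41], [GelbartRogawski1991, §3], non-vanishing [Li1992, Thm 2.1];
  model reuse: ★ `ThetaDistDatum.dist`/`dist_ωf_V`/`dist_ωf_W`/`dist_mem_weightForms`/`isHolGerm_dist`, ★ `weilCoinvLift`/`weilCoinvLift_eq_zero_iff`).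
  **T3b `stub_T3b_conjugatePartnerAt`** (M): the weight-one admissible family is CLOSED UNDER COMPLEX CONJUGATION with the `ι₁`-class flipped — every such `t`
  has a weight-one admissible `t'` (`μ' = μ ∘ c`, `e' = −e`, `χ' = χ̄`) with `ι₁ ∈ Φ_{μ'} ↔ ι₁ ∉ Φ_μ` and a conjugate-linear `rho`-equivariant bijection
  `ω_V(t) → ω_V(t')` (complex conjugation of Schwartz functions on the χ-coinvariants, [Liu2021, Def. 4.11, Lem. D.1]; [GelbartRogawski1991, §3 Prop. 3.1.1]).
  KERNEL GLUE `stubT3_of`: a triple of the «other» class is realised ANTI-holomorphically by `conjFun ∘ θ_{t'} ∘ J` (`conjFun` commutes with `rightRep`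
  by `rfl`), whence values in `cohForms 𝔞₀` — so v2.1's T3 follows with no convention risk.

KERNEL-CHECKED (no hole): `stubT2_of : T2a → T2b → T2c → StubT2MatsushimaHodgeAt`, `stubT3_of : T3a → T3b → StubT3ThetaFormsAt`, v2.1's
`occursInH1_of_classMap_of_thetaForms` ∕ `admissible_occursInH1_holds_of` (verbatim), `hocc_of_stubs : HoccType` (zero hypotheses beyond the five
`stub_*`), and the head of record `H413_of_P4 : T2a → T2b → T2c → T3a → T3b → HdictEType → HJ3aType → …Theses.HCCMUnconditional.H413` (via ★
`Hyp413Closing.H413_of_three_facts_flat`; `hdictE`/`hJ3a` = programmes P2 ∕ P3, NOT re-declared).  Registered holes = EXACTLY the five `stub_*`.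
STAFF FIRST: T2a (A-p13, in hand) ∥ T3a (the L-sized one; two seats: theta-distribution junction + non-vanishing) → T2b → T3b → T2c.
Barriers: none catalogued for HodgeConjecture in this technique class (`Literature/Barriers/HodgeConjecture/` has no theta ∕ Matsushima entry).
Dead lines avoided: «occurs ⇒ admissible» ∕ `muAdmissible_iff_multiplicity_one` (refuted on non-global `ε`, E-III2) is not claimed; no `∀ 𝔞, IsHonest 𝔞 →`
binders (v1); no Hodge-type assignment by convention (T3 split is a disjunction); no import of `Cruxes/**/Lines/*` workfiles.

## References
* [Liu2021] Y. Liu, *Fourier–Jacobi cycles and arithmetic relative trace formula*, Camb. J. Math. 9 (2021) = arXiv:2102.11518 — Prop. 4.13 and its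
  proof (l. 2145 «Conversely …»), Def. 4.11–4.12, App. D Lem. D.1, D.2.
* [GelbartRogawski1991] S. Gelbart, J. Rogawski, Invent. Math. 105 (1991) — §3 Prop. 3.1.1, Thm. 5.1.1.  [Li1992] J.-S. Li, J. reine angew. Math. 428 (1992), Thm. 2.1.
* [Weil1964] A. Weil, Acta Math. 111 (1964), n° 37–41.  [KonnoKonno2007] T. Konno, K. Konno, Kyushu J. Math. 61 (2007), Thm. 5.4.
* [HarrisKudlaSweet1996] M. Harris, S. Kudla, W. J. Sweet, J. Amer. Math. Soc. 9 (1996), §1 (1.5).  [Kudla1994] S. Kudla, Israel J. Math. 87 (1994), §1–2.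
  [MoeglinVignerasWaldspurger1987] C. Mœglin, M.-F. Vignéras, J.-L. Waldspurger, LNM 1291 (1987), Chap. 2 II, Chap. 3 I.1–I.3.
* [BorelWallach2000] A. Borel, N. Wallach, Math. Surveys Monogr. 67 (2000), VII 2.10, 3.2, 3.6; XIII 1.2.  [VoisinHodgeI2002] C. Voisin, Hodge Theory I, §7.1, Cor. 7.6.
* [DeligneHodgeII1971] P. Deligne, Théorie de Hodge II, 1.2.5 (opposed filtrations).  [Borel1997] A. Borel, *Automorphic forms on SL₂(ℝ)*, §5.14.
* Tree: ★ `Theorems/HCCMUnconditionalOfGenericFloorV7`, ★ `CorCM/Hyp413/A3Liu413FaceTypes` (`datum413`), ★ `Theorems/HCCMUnconditionalH413OfFacts`,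
  ★ `Theorems/H413CohFormsCarriers` (carriers, `archFactorOf`), ★ `HodgeCM/Model/{TowerLevel_1,TowerCarrier,Universe,ClassMapInstance,AdelicThetaTowerClass}`,
  ★ `Literature/AlgebraicGeometry/Motives/HodgeStructure` (`isCompl_F_complexConj`), ★ `GelbartRogawski1991/OscillatorTripleDictionary` (`OccursInH1`, `rhoTriple`).
-/

set_option autoImplicit false

-- the mandated namespace has the single-problem summit's repeated segment (`HodgeConjecture.HodgeConjecture`), as in every
-- `Cruxes/…/Lines/*.lean` and `Theorems/*.lean` of this sub-problem
set_option linter.dupNamespace false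

noncomputable section

namespace Summit.HodgeConjecture.HodgeConjecture.Cruxes.H413.F0P4AdmissibleOccursInH1

open scoped TensorProduct Matrix
open NumberField NumberField.InfinitePlace IsDedekindDomain
open HodgeCM.Model HodgeCM.Model.LiuIndex HodgeCM.Model.TowerCarrier
open Summit.HodgeConjecture.CorCM.Model
open Literature.AlgebraicGeometry.Motives (CMType AbelianVariety)
open Literature.AlgebraicGeometry.HodgeTheory Literature.NumberTheory.Automorphic.PicardCM
open Literature.AlgebraicGeometry.ShimuraVarieties Literature.AlgebraicGeometry.ShimuraVarieties.UnitaryCanonicalModel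
open Literature.NumberTheory.ComplexMultiplication
open Literature.NumberTheory.Automorphic
open Literature.NumberTheory.Automorphic.Liu2021 Literature.NumberTheory.Automorphic.Liu2021.AppendixC
open Literature.NumberTheory.Automorphic.Liu2021.Def411WeilCarriers (lineOf locF Rep)
open Summit.HodgeConjecture.CorCM.Transposition.OmegaTransport (realUnit)
open HodgeCM.Model.ArchSideTerm (e₁)
open Literature.NumberTheory.GelbartRogawski1991 Literature.NumberTheory.GelbartRogawski1991.UnitaryDualPair
open Literature.RepresentationTheory Literature.RepresentationTheory.Liu2021
open Summit.HodgeConjecture.CorCM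
open Summit.HodgeConjecture.CorCM.Transposition
open Literature.NumberTheory.GelbartRogawski1991.OscillatorTripleDictionary (OccursInH1 IsIsoToOmega)
open Summit.HodgeConjecture.CorCM.Lines.A3Liu418 (Thm415AtFace EpsRigidAtFace)
open Summit.HodgeConjecture.HodgeConjecture.Theses (HCCMUnconditional.HDel)
open MulAction
open Literature.Geometry.ComplexHyperbolic.BallModel (U21 x₀)
open Literature.NumberTheory.GelbartRogawski1991.OscillatorTripleDictionary (rhoTriple)
open Summit.HodgeConjecture.CorCM.Lines.A3Liu413 (datum413)

/-! ## §0 The three binder types of the floor, VERBATIM (floor V7 ll. 71–85; brief §1) -/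

set_option synthInstance.maxHeartbeats 400000 in
set_option maxHeartbeats 8000000 in
/-- **`HoccType`** — the TYPE of the `hocc` binder of ★ `hc_cm_of_generic_floor_v7` (ll. 81–85), token-for-token = the registered stub
`stub_admissible_occursInH1` of `Cruxes/H413/Lines/a3_liu413.lean` v10.2: row III-2 (c)′, the OCCURRENCE direction of
[Liu2021, proof of Prop. 4.13, l. 2145] at admissible weight-one triples of the pin's datum. (print: Liu2021, proof of Prop. 4.13, l. 2145)
(print: GelbartRogawski1991, Thm 5.1.1 p. 465) (print: Li1992, Thm. 2.1) -/
def HoccType : Prop :=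
  ∀ (hDel : Literature.AlgebraicGeometry.ShimuraVarieties.UnitaryCanonicalModel.canonicalModel_exists_printed)
    (F : HodgeCM.CMField) [IsGalois ℚ F] (h6 : 6 ≤ Module.finrank ℚ F) {ι₁ : F →+* ℂ} (V : HodgeCM.HermSpace3 F ι₁) (a₀ : RealScalar F)
    (Φ : CMType F) (hΦ : ι₁ ∈ Φ.1) (i : (I V (repAt a₀) (muLiu ι₁ GramClass.rep))),
    admissible_occursInH1 (((uniformOmegaRep (Summit.HodgeConjecture.CorCM.DelRec.exists_recordSystem_of_printed hDel) ⟨HodgeCM.CMField.K F⟩ ι₁ ⟨HodgeCM.HermSpace3.Hm V, HodgeCM.HermSpace3.isHermitian V, HodgeCM.HermSpace3.signature_ι₁ V, HodgeCM.HermSpace3.posDef_of_ne V⟩ Φ e₁ (frameD V) (frameD_real V) (frameD_ne V) (ιVE V) (2 * imagUnit (HodgeCM.CMField.K F))⁻¹ (fun _ _ => (Rep.update ↥(maximalRealSubfield (HodgeCM.CMField.K F)) (imagUnitSq (HodgeCM.CMField.K F)) (Rep.ofLineOf ↥(maximalRealSubfield (HodgeCM.CMField.K F)) (imagUnitSq (HodgeCM.CMField.K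 F))) (locF ↥(maximalRealSubfield (HodgeCM.CMField.K F)) (imagUnitSq (HodgeCM.CMField.K F)) (realUnit ⟨HodgeCM.CMField.K F⟩ (repAt a₀ (Sigma.fst i)).1 (repAt a₀ (Sigma.fst i)).2.1 (repAt a₀ (Sigma.fst i)).2.2)) (realUnit ⟨HodgeCM.CMField.K F⟩ (repAt a₀ (Sigma.fst i)).1 (repAt a₀ (Sigma.fst i)).2.1 (repAt a₀ (Sigma.fst i)).2.2) rfl)))).prop413Data ((liuDictionaryPin exists_isReal_hodgeModel_holds hodgePQ_independent_of_hodgeModel_holds BallQuotient.ballQuotientUniformised_holds (cmAbelianVarietyRealised_of_eigenbasis exists_isReal_hodgeModel_holds hodgePQ_independent_of_hodgeModel_holds cmAbelianVarietyEigenbasisRealised_holds) Literature.NumberTheory.Transcendental.arapura2012_cor_15_4_6_holds V (I V (repAt a₀) (muLiu ι₁ GramClass.rep)) (line V (repAt a₀) (muLiu ι₁ GramClass.rep)))).H)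

set_option synthInstance.maxHeartbeats 400000 in
set_option maxHeartbeats 8000000 in
/-- **`HdictEType`** — the TYPE of the `hdictE` binder of ★ `hc_cm_of_generic_floor_v7` (ll. 71–75), row III-2 (a)′ (existence half of the
oscillator-triple dictionary), VERBATIM; programme P2's target, an INPUT of the second head only. (print: Liu2021, proof of Prop. 4.13, l. 2145)
(print: GelbartRogawski1991, Introduction p. 448; Thm 5.1.1 p. 465) -/
def HdictEType : Prop :=
  ∀ (hDel : Literature.AlgebraicGeometry.ShimuraVarieties.UnitaryCanonicalModel.canonicalModel_exists_printed)
    (F : HodgeCM.CMField) [IsGalois ℚ F] (h6 : 6 ≤ Module.finrank ℚ F) {ι₁ : F →+* ℂ} (V : HodgeCM.HermSpace3 F ι₁) (a₀ : RealScalar F)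
    (Φ : CMType F) (hΦ : ι₁ ∈ Φ.1) (i : (I V (repAt a₀) (muLiu ι₁ GramClass.rep))),
    oscillatorTriple_dictionaryExistence (((uniformOmegaRep (Summit.HodgeConjecture.CorCM.DelRec.exists_recordSystem_of_printed hDel) ⟨HodgeCM.CMField.K F⟩ ι₁ ⟨HodgeCM.HermSpace3.Hm V, HodgeCM.HermSpace3.isHermitian V, HodgeCM.HermSpace3.signature_ι₁ V, HodgeCM.HermSpace3.posDef_of_ne V⟩ Φ e₁ (frameD V) (frameD_real V) (frameD_ne V) (ιVE V) (2 * imagUnit (HodgeCM.CMField.K F))⁻¹ (fun _ _ => (Rep.update ↥(maximalRealSubfield (HodgeCM.CMField.K F)) (imagUnitSq (HodgeCM.CMField.K F)) (Rep.ofLineOf ↥(maximalRealSubfield (HodgeCM.CMField.K F)) (imagUnitSq (HodgeCM.CMField.K F))) (locF ↥(maximalRealSubfield (HodgeCM.CMField.K F)) (imagUnitSq (HodgeCM.CMField.K F)) (realUnit ⟨HodgeCM.CMField.K F⟩ (repAt a₀ (Sigma.fst i)).1 (repAt a₀ (Sigma.fst i)).2.1 (repAt a₀ (Sigma.fst i)).2.2))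 (realUnit ⟨HodgeCM.CMField.K F⟩ (repAt a₀ (Sigma.fst i)).1 (repAt a₀ (Sigma.fst i)).2.1 (repAt a₀ (Sigma.fst i)).2.2) rfl)))).prop413Data ((liuDictionaryPin exists_isReal_hodgeModel_holds hodgePQ_independent_of_hodgeModel_holds BallQuotient.ballQuotientUniformised_holds (cmAbelianVarietyRealised_of_eigenbasis exists_isReal_hodgeModel_holds hodgePQ_independent_of_hodgeModel_holds cmAbelianVarietyEigenbasisRealised_holds) Literature.NumberTheory.Transcendental.arapura2012_cor_15_4_6_holds V (I V (repAt a₀) (muLiu ι₁ GramClass.rep)) (line V (repAt a₀) (muLiu ι₁ GramClass.rep)))).H)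

set_option synthInstance.maxHeartbeats 400000 in
set_option maxHeartbeats 8000000 in
/-- **`HJ3aType`** — the TYPE of the `hJ3a` binder of ★ `hc_cm_of_generic_floor_v7` (ll. 76–80), row III-J3a (multiplicity `≤ 1`), VERBATIM;
programme P3's target, an INPUT of the second head only. (print: Liu2021, proof of Prop. 4.13, l. 2145) (print: Rogawski1990, Thm. 13.3.1) -/
def HJ3aType : Prop :=
  ∀ (hDel : Literature.AlgebraicGeometry.ShimuraVarieties.UnitaryCanonicalModel.canonicalModel_exists_printed)
    (F : HodgeCM.CMField) [IsGalois ℚ F] (h6 : 6 ≤ Module.finrank ℚ F) {ι₁ : F →+* ℂ} (V : HodgeCM.HermSpace3 F ι₁) (a₀ : RealScalar F)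
    (Φ : CMType F) (hΦ : ι₁ ∈ Φ.1) (i : (I V (repAt a₀) (muLiu ι₁ GramClass.rep))),
    (((uniformOmegaRep (Summit.HodgeConjecture.CorCM.DelRec.exists_recordSystem_of_printed hDel) ⟨HodgeCM.CMField.K F⟩ ι₁ ⟨HodgeCM.HermSpace3.Hm V, HodgeCM.HermSpace3.isHermitian V, HodgeCM.HermSpace3.signature_ι₁ V, HodgeCM.HermSpace3.posDef_of_ne V⟩ Φ e₁ (frameD V) (frameD_real V) (frameD_ne V) (ιVE V) (2 * imagUnit (HodgeCM.CMField.K F))⁻¹ (fun _ _ => (Rep.update ↥(maximalRealSubfield (HodgeCM.CMField.K F)) (imagUnitSq (HodgeCM.CMField.K F)) (Rep.ofLineOf ↥(maximalRealSubfield (HodgeCM.CMField.K F)) (imagUnitSq (HodgeCM.CMField.K F))) (locF ↥(maximalRealSubfield (HodgeCM.CMField.K F)) (imagUnitSq (HodgeCM.CMField.K F)) (realUnit ⟨HodgeCM.CMField.K F⟩ (repAt a₀ (Sigma.fst i)).1 (repAt a₀ (Sigma.fst i)).2.1 (repAt a₀ (Sigma.fst i)).2.2)) (realUnit ⟨HodgeCM.CMField.K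 F⟩ (repAt a₀ (Sigma.fst i)).1 (repAt a₀ (Sigma.fst i)).2.1 (repAt a₀ (Sigma.fst i)).2.2) rfl)))).prop413Data ((liuDictionaryPin exists_isReal_hodgeModel_holds hodgePQ_independent_of_hodgeModel_holds BallQuotient.ballQuotientUniformised_holds (cmAbelianVarietyRealised_of_eigenbasis exists_isReal_hodgeModel_holds hodgePQ_independent_of_hodgeModel_holds cmAbelianVarietyEigenbasisRealised_holds) Literature.NumberTheory.Transcendental.arapura2012_cor_15_4_6_holds V (I V (repAt a₀) (muLiu ι₁ GramClass.rep)) (line V (repAt a₀) (muLiu ι₁ GramClass.rep)))).H).multiplicity_le_one_printed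

/-! ## §1 The carriers — IN THE TREE BY NAME: `Theorems/H413CohFormsCarriers.lean` (`adelicDatum`, `finToAdelic`, `ArchFactor`, `rightRep`, `smoothFun`,
`conjFun`, `holCotForms`, `cohForms`, `archFactorOf`; ns `Summit.HodgeConjecture.HodgeConjecture.Cruxes.H413.CohFormsCarriers`, opened below). -/

open Summit.HodgeConjecture.HodgeConjecture.Cruxes.H413.CohFormsCarriers

/-! ## §2 The two NODES of the line of record (v2.1 `P4AdmissibleOccursInH1`, VERBATIM) — theorems of the five stubs of §3 (see §4) -/

set_option synthInstance.maxHeartbeats 400000 in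
set_option maxHeartbeats 8000000 in
/-- STUB TYPE **T2 — MATSUSHIMA–HODGE CLASS MAP AT THE PIN** (M–L; FLOOR0-PLAN T1 + T5a + the Hodge-type half of T2): for every face and every `τ'`,
at THE archimedean factor of record `𝔞₀ = archFactorOf F V` (carriers §3), there is a `ℂ`-linear CLASS MAP `cls : cohForms 𝔞₀ → H¹_{B,τ'}(A_∞, ℂ)` into the PIN's tower module
(`(datum413 …).HB τ'` with its `ℂ[U(V)(𝔸_{F⁺,f})]`-action `rhoB τ'`) which is INJECTIVE and `U(V)(𝔸_{F⁺,f})`-EQUIVARIANT for right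
translation.  Content: at each level `Γ`, a (anti)holomorphic cotangent form of level `Γ.K` IS a `(1,0)`/`(0,1)`-form on `P_Γ(V) = Γ\𝔹²`
([Borel1997, §5.14]; ★ `Model.classMapDatumOf`: `descends`, `pull_injective`) whose de Rham class is non-zero when the form is
(Hodge theory on the compact Kähler surface `P_Γ`, [VoisinHodgeI2002, Cor. 7.6]; ★ `F¹H¹`); the classes are compatible with pull-back and
Hecke translation in the tower (Matsushima–Murakami functoriality, [BorelWallach2000, VII 3.2, 3.6; XIII 1.2]; binder-1 `ofLevel`/`towerFamily`,
sinst-1 `of_smul_clsAt` for the theta instance), hence assemble to an injective equivariant map into `H = colim_K H¹`.  Why it might fail: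
the pin's `H` is the tower of the IDENTITY components `P_Γ`; a form of level `K` has classes on every component `X_K = ∐ P_{Γ_h}` —
the tower is built exactly as `colim_K ⊕_h H¹(P_{Γ_h})` (`LiuDictionary` docstring (α4)), so injectivity holds; if a reviewer reads `H`
otherwise, restrict `cls` to forms supported on the identity double coset (reshaping, not failure).
(print: BorelWallach2000, VII 3.2, VII 3.6, XIII 1.2) (print: VoisinHodgeI2002, Cor. 7.6) (print: Borel1997, §5.14) (print: MatsushimaMurakami1963, §4) -/
def StubT2MatsushimaHodgeAt : Prop :=
  ∀ (hDel : Literature.AlgebraicGeometry.ShimuraVarieties.UnitaryCanonicalModel.canonicalModel_exists_printed)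
      (F : HodgeCM.CMField) [IsGalois ℚ F] (h6 : 6 ≤ Module.finrank ℚ F) {ι₁ : F →+* ℂ} (V : HodgeCM.HermSpace3 F ι₁) (a₀ : RealScalar F)
      (Φ : CMType F) (hΦ : ι₁ ∈ Φ.1) (i : (I V (repAt a₀) (muLiu ι₁ GramClass.rep))),
      3 ≤ (datum413 hDel F V a₀ Φ i).n → ∀ τ' : HodgeCM.CMField.K F →+* ℂ,
        ∃ cls : ↥(cohForms (archFactorOf F V)) →ₗ[ℂ] (datum413 hDel F V a₀ Φ i).HB τ',
          Function.Injective cls ∧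
            ∀ (g : ↥(HodgeCM.HermSpace3.adelicFin V)) (f : ↥(cohForms (archFactorOf F V)))
              (hgf : rightRep F V g (f : _) ∈ cohForms (archFactorOf F V)),
              cls ⟨rightRep F V g (f : _), hgf⟩ = (datum413 hDel F V a₀ Φ i).rhoB τ' g (cls f)

set_option synthInstance.maxHeartbeats 400000 in
set_option maxHeartbeats 8000000 in
/-- STUB TYPE **T3 — THE GLOBAL THETA LIFT PRODUCES NON-ZERO COHOMOLOGICAL COTANGENT FORMS OUT OF `ω_V(t)`** (L–XL; FLOOR0-PLAN T3 + T4;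
Liu's «Conversely …» sentence minus cohomology): for every face, at `n = 3`, at the factor of record `𝔞₀ = archFactorOf F V`, and every triple `t = (μ, ε, χ)` of the pin
with `μ` OF WEIGHT ONE and `ε` `μ`-ADMISSIBLE, there is a `ℂ`-linear map `θ : ω_V(t) → (U(V)(𝔸_{F⁺}) → ℂ²)` which is NON-ZERO,
`U(V)(𝔸_{F⁺,f})`-EQUIVARIANT (`θ (ω_V(t)(g) v) = R_g (θ v)`) and takes values in `cohForms 𝔞₀`.  Content: `θ(Φ_f) := Θ(φ_∞^{harm} ⊗ Φ_f)` the
theta kernel of the dual pair `(U(W_t), U(V))`, `W_t` the hermitian LINE of record of the class `ε` (the pin's `Rep.update … (realUnit …)`),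
with splitting character `μ` ([GelbartRogawski1991, §3 Prop. 3.1.1]; [Weil1964, n° 41 Thm. 6]: automorphy = left `U(V)(F⁺)`-invariance,
continuity ⇒ smoothness), integrated against `χ` on the compact `[U(W_t)]` — it is `χ`-covariant hence factors through the `χ`-coinvariants
`ω_V(t) = ⊗'_v ω(μ_v, ε_v, χ_v)` (the tree's `rhoAtLine` IS that coinvariant quotient: `TwistedCoinv`); the archimedean vector `φ_∞^{harm}` of
`K_∞`-type `(weightOf x₀)^∨` annihilated by `𝔭⁻` EXISTS in `ω(μ_{ι₁}, ε_{ι₁}, χ_{ι₁})` iff `μ` has weight one and `ε` is `μ`-admissible with the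
sign read at `ι₁` ([Liu2021, Lem. D.2 (2)] ⟸ [KonnoKonno2007, Thm. 5.4]; the other sign gives the conjugate type, whence `cohForms` and not
`holCotForms`), the Gaussian at the definite places is `K_c`-fixed ([Liu2021, Lem. D.2 (1)]); NON-VANISHING of the lift = Rallis inner
product formula in the stable range `dim W = 1 < 3/2` ([Li1992, Thm. 2.1]; [Rallis1984]).  Promote/split candidates (card §Stubs): T3a theta
kernel + descent, T3b archimedean harmonic vector, T3c Rallis — once the adèlic Weil representation of the pair at the pin is a typed carrier
(P2-U2/U3 share it).  Why it might fail: as printed it cannot (l. 2145); at the pin only through the identification of the tree's `rhoAtLine`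
with Liu's `ω(μ,ε,χ)` on the line of record — which is what rows hD1″/h411 already certified (`Def411WeilCarriers*`).
(print: Liu2021, proof of Prop. 4.13, l. 2145; App. D Lem. D.2 (1)(2)) (print: GelbartRogawski1991, §3 Prop. 3.1.1 (p. 455); Thm 5.1.1 (p. 465))
(print: Weil1964, n° 41 Thm. 6) (print: Li1992, Thm. 2.1) (print: KonnoKonno2007, Thm. 5.4) -/
def StubT3ThetaFormsAt : Prop :=
  ∀ (hDel : Literature.AlgebraicGeometry.ShimuraVarieties.UnitaryCanonicalModel.canonicalModel_exists_printed)
      (F : HodgeCM.CMField) [IsGalois ℚ F] (h6 : 6 ≤ Module.finrank ℚ F) {ι₁ : F →+* ℂ} (V : HodgeCM.HermSpace3 F ι₁) (a₀ : RealScalar F)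
      (Φ : CMType F) (hΦ : ι₁ ∈ Φ.1) (i : (I V (repAt a₀) (muLiu ι₁ GramClass.rep))),
      (datum413 hDel F V a₀ Φ i).n = 3 →
        ∀ (t : (datum413 hDel F V a₀ Φ i).Triple), t.HasWeightOne → t.IsAdmissible →
          ∃ θ : (datum413 hDel F V a₀ Φ i).omega t.μ t.isConjugateSymplectic t.ε t.χ →ₗ[ℂ]
              ((adelicDatum F V).Adelic → (Fin 2 → ℂ)),
            θ ≠ 0 ∧ (∀ v, θ v ∈ cohForms (archFactorOf F V)) ∧
              ∀ (g : ↥(HodgeCM.HermSpace3.adelicFin V)) (v : (datum413 hDel F V a₀ Φ i).omega t.μ t.isConjugateSymplectic t.ε t.χ),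
                θ (rhoTriple (datum413 hDel F V a₀ Φ i) t g v) = rightRep F V g (θ v)

/-! ## §3 The SIX registered P4 stubs (ED. 1.1: T3a = T3n (Rallis, shared with P2) + T3a′) (each stated over tree declarations only; the `(1,0)`-part of the tower is written inline) -/

set_option synthInstance.maxHeartbeats 400000 in
set_option maxHeartbeats 8000000 in
/-- STUB TYPE **T2a — HOLOMORPHIC MATSUSHIMA–HODGE CLASS MAP WITH `(1,0)` RANGE** (M): for every face (`3 ≤ n`) and every `τ'`, at the factor of
record `𝔞₀ = archFactorOf F V`, there is an INJECTIVE, `U(V)(𝔸_{F⁺,f})`-EQUIVARIANT `ℂ`-linear class map `cls₁₀ : holCotForms 𝔞₀ → H¹_{B,τ'}(A_∞, ℂ)`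
(the pin's tower module `(datum413 hDel F V a₀ Φ i).HB τ' = Tower … V`) whose values lie in the HODGE `(1,0)`-PART OF THE TOWER: the span of the
`ofLevel`-images of level families `c ∈ towerLevel Δ` all of whose components `c h ∈ H¹(X_{Δ^h}; ℂ)` lie in `F¹` (★ `universeOf….hodge … 1 .F 1`
= `(pinD …).H10` by ★ `classMapDatumOf_H10`).  Content: levelwise a holomorphic cotangent form IS a holomorphic `1`-form on `P_Γ(V)` with a class in
`F¹H¹` ([Borel1997, §5.14]; ★ `classMapDatumOf`: `descends`, `pull_injective`), non-zero when the form is ([VoisinHodgeI2002, Cor. 7.6]); tower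
compatibility = Matsushima–Murakami functoriality ([BorelWallach2000, VII 3.2, 3.6; XIII 1.2]).  In hand: A-p13 (g21) `H413CuspCotComponents` ∕ `Tower` ∕
`Transport` (`compClass`, `towerFamily_mem`, `clsAt`, `of_smul_clsAt`, `clsAt_of_le`, `clsAt_eq_zero_iff`, `toRegimeFun_mem_cuspCotSat`) — what remains is ONE
map on the union over levels (`clsAt_of_le`) and `rhoB τ' g = act g` (Mathlib `Representation.ofModule'` round trip).  Why it might fail: only through a
mismatch of the inline `(1,0)`-part with the prover's family shape (it is `towerFamily_mem`'s shape by construction) — a reshaping, not mathematics.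
(print: BorelWallach2000, VII 3.2, VII 3.6, XIII 1.2) (print: VoisinHodgeI2002, Cor. 7.6) (print: Borel1997, §5.14) -/
def StubT2aHolClassMapAt : Prop :=
  ∀ (hDel : Literature.AlgebraicGeometry.ShimuraVarieties.UnitaryCanonicalModel.canonicalModel_exists_printed)
      (F : HodgeCM.CMField) [IsGalois ℚ F] (h6 : 6 ≤ Module.finrank ℚ F) {ι₁ : F →+* ℂ} (V : HodgeCM.HermSpace3 F ι₁) (a₀ : RealScalar F)
      (Φ : CMType F) (hΦ : ι₁ ∈ Φ.1) (i : (I V (repAt a₀) (muLiu ι₁ GramClass.rep))),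
      3 ≤ (datum413 hDel F V a₀ Φ i).n → ∀ τ' : HodgeCM.CMField.K F →+* ℂ,
        ∃ cls₁₀ : ↥(holCotForms (archFactorOf F V)) →ₗ[ℂ] (datum413 hDel F V a₀ Φ i).HB τ',
          Function.Injective cls₁₀ ∧
            (∀ (g : ↥(HodgeCM.HermSpace3.adelicFin V)) (f : ↥(holCotForms (archFactorOf F V)))
                (hgf : rightRep F V g (f : _) ∈ holCotForms (archFactorOf F V)),
                cls₁₀ ⟨rightRep F V g (f : _), hgf⟩ = (datum413 hDel F V a₀ Φ i).rhoB τ' g (cls₁₀ f)) ∧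
            ∀ f : ↥(holCotForms (archFactorOf F V)), cls₁₀ f ∈
              (⨆ j : HodgeCM.TLvl V,
                ((Submodule.pi Set.univ fun h : ↥(HodgeCM.HermSpace3.adelicFin V) =>
                      ((HodgeCM.Model.universeOf exists_isReal_hodgeModel_holds hodgePQ_independent_of_hodgeModel_holds (ballQuotientUniformisedDatum_of BallQuotient.ballQuotientUniformised_holds) (cmAbelianVarietyRealised_of_eigenbasis exists_isReal_hodgeModel_holds hodgePQ_independent_of_hodgeModel_holds cmAbelianVarietyEigenbasisRealised_holds)).hodge
                          ((HodgeCM.Model.universeOf exists_isReal_hodgeModel_holds hodgePQ_independent_of_hodgeModel_holds (ballQuotientUniformisedDatum_of BallQuotient.ballQuotientUniformised_holds) (cmAbelianVarietyRealised_of_eigenbasis exists_isReal_hodgeModel_holds hodgePQ_independent_of_hodgeModel_holds cmAbelianVarietyEigenbasisRealised_holds)).pms F ι₁ V (j.1.conj h j.2)) 1).F 1).comap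
                    (HodgeCM.Model.TowerLevel.towerLevel exists_isReal_hodgeModel_holds hodgePQ_independent_of_hodgeModel_holds (ballQuotientUniformisedDatum_of BallQuotient.ballQuotientUniformised_holds) (cmAbelianVarietyRealised_of_eigenbasis exists_isReal_hodgeModel_holds hodgePQ_independent_of_hodgeModel_holds cmAbelianVarietyEigenbasisRealised_holds) Literature.NumberTheory.Transcendental.arapura2012_cor_15_4_6_holds j.1 j.2).subtype).map
                  (HodgeCM.Model.TowerCarrier.ofLevel exists_isReal_hodgeModel_holds hodgePQ_independent_of_hodgeModel_holds (ballQuotientUniformisedDatum_of BallQuotient.ballQuotientUniformised_holds) (cmAbelianVarietyRealised_of_eigenbasis exists_isReal_hodgeModel_holds hodgePQ_independent_of_hodgeModel_holds cmAbelianVarietyEigenbasisRealised_holds) Literature.NumberTheory.Transcendental.arapura2012_cor_15_4_6_holds j.1 j.2) :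
                Submodule ℂ ((datum413 hDel F V a₀ Φ i).HB τ'))

set_option synthInstance.maxHeartbeats 400000 in
set_option maxHeartbeats 8000000 in
/-- STUB TYPE **T2b — COMPLEX CONJUGATION ON THE PIN'S TOWER, HODGE-DISJOINT FROM THE `(1,0)`-PART** (M): for every face and every `τ'` there is an
INJECTIVE CONJUGATE-LINEAR map `cB : H¹_{B,τ'} → H¹_{B,τ'}` commuting with the pin's action `rhoB τ'` and such that the `(1,0)`-part `H10T` of the tower (same
inline term as in T2a) meets its conjugate `cB(H10T)` only in `0`.  Content: levelwise `cB_Δ = conj ⊗ id` on `H¹(X_Δ; ℂ) = ℂ ⊗_ℚ H¹(X_Δ; ℚ)`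
(★ `Universe.CohC`, ★ `HodgeStructure.complexConj`), compatible with the `ℚ`-RATIONAL transition and translation maps `trPull`/`restrictLevel`/`translate`
(★ `Universe.pull`, so it descends to `Module.DirectLimit` and commutes with `act` = `rhoB`), and `F¹ ∩ conj F¹ = 0` in weight `1` is the opposedness
axiom ★ `HodgeStructure.isCompl_F_complexConj 1 1` of the REAL Hodge structure ([DeligneHodgeII1971, 1.2.5]; [VoisinHodgeI2002, §7.1]); disjointness passes to
the directed union over `TLvl V` (common refinement `Level.capThree`, injective… not needed: equality in the limit is equality at a finer level, and the
transitions preserve `F¹` and `conj F¹`, ★ `trPull_mem_H10`).  Why it might fail: a conjugate-linear endomorphism of a `Module.DirectLimit` is not a stock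
Mathlib construction (`DirectLimit.map` is linear) — build it with `DirectLimit.lift` into the conjugate module; mathematics cannot fail.
(print: VoisinHodgeI2002, §7.1 and Cor. 7.6) (print: DeligneHodgeII1971, 1.2.5) (print: BorelWallach2000, VII 2.10) -/
def StubT2bTowerConjugationAt : Prop :=
  ∀ (hDel : Literature.AlgebraicGeometry.ShimuraVarieties.UnitaryCanonicalModel.canonicalModel_exists_printed)
      (F : HodgeCM.CMField) [IsGalois ℚ F] (h6 : 6 ≤ Module.finrank ℚ F) {ι₁ : F →+* ℂ} (V : HodgeCM.HermSpace3 F ι₁) (a₀ : RealScalar F)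
      (Φ : CMType F) (hΦ : ι₁ ∈ Φ.1) (i : (I V (repAt a₀) (muLiu ι₁ GramClass.rep))),
      ∀ τ' : HodgeCM.CMField.K F →+* ℂ,
        ∃ cB : (datum413 hDel F V a₀ Φ i).HB τ' →ₛₗ[starRingEnd ℂ] (datum413 hDel F V a₀ Φ i).HB τ',
          Function.Injective cB ∧
            (∀ (g : ↥(HodgeCM.HermSpace3.adelicFin V)) (x : (datum413 hDel F V a₀ Φ i).HB τ'),
                cB ((datum413 hDel F V a₀ Φ i).rhoB τ' g x) = (datum413 hDel F V a₀ Φ i).rhoB τ' g (cB x)) ∧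
            ∀ x y : (datum413 hDel F V a₀ Φ i).HB τ',
              x ∈ (⨆ j : HodgeCM.TLvl V,
                ((Submodule.pi Set.univ fun h : ↥(HodgeCM.HermSpace3.adelicFin V) =>
                      ((HodgeCM.Model.universeOf exists_isReal_hodgeModel_holds hodgePQ_independent_of_hodgeModel_holds (ballQuotientUniformisedDatum_of BallQuotient.ballQuotientUniformised_holds) (cmAbelianVarietyRealised_of_eigenbasis exists_isReal_hodgeModel_holds hodgePQ_independent_of_hodgeModel_holds cmAbelianVarietyEigenbasisRealised_holds)).hodge
                          ((HodgeCM.Model.universeOf exists_isReal_hodgeModel_holds hodgePQ_independent_of_hodgeModel_holds (ballQuotientUniformisedDatum_of BallQuotient.ballQuotientUniformised_holds) (cmAbelianVarietyRealised_of_eigenbasis exists_isReal_hodgeModel_holds hodgePQ_independent_of_hodgeModel_holds cmAbelianVarietyEigenbasisRealised_holds)).pms F ι₁ V (j.1.conj h j.2)) 1).F 1).comap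
                    (HodgeCM.Model.TowerLevel.towerLevel exists_isReal_hodgeModel_holds hodgePQ_independent_of_hodgeModel_holds (ballQuotientUniformisedDatum_of BallQuotient.ballQuotientUniformised_holds) (cmAbelianVarietyRealised_of_eigenbasis exists_isReal_hodgeModel_holds hodgePQ_independent_of_hodgeModel_holds cmAbelianVarietyEigenbasisRealised_holds) Literature.NumberTheory.Transcendental.arapura2012_cor_15_4_6_holds j.1 j.2).subtype).map
                  (HodgeCM.Model.TowerCarrier.ofLevel exists_isReal_hodgeModel_holds hodgePQ_independent_of_hodgeModel_holds (ballQuotientUniformisedDatum_of BallQuotient.ballQuotientUniformised_holds) (cmAbelianVarietyRealised_of_eigenbasis exists_isReal_hodgeModel_holds hodgePQ_independent_of_hodgeModel_holds cmAbelianVarietyEigenbasisRealised_holds) Literature.NumberTheory.Transcendental.arapura2012_cor_15_4_6_holds j.1 j.2) :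
                Submodule ℂ ((datum413 hDel F V a₀ Φ i).HB τ')) →
              y ∈ (⨆ j : HodgeCM.TLvl V,
                ((Submodule.pi Set.univ fun h : ↥(HodgeCM.HermSpace3.adelicFin V) =>
                      ((HodgeCM.Model.universeOf exists_isReal_hodgeModel_holds hodgePQ_independent_of_hodgeModel_holds (ballQuotientUniformisedDatum_of BallQuotient.ballQuotientUniformised_holds) (cmAbelianVarietyRealised_of_eigenbasis exists_isReal_hodgeModel_holds hodgePQ_independent_of_hodgeModel_holds cmAbelianVarietyEigenbasisRealised_holds)).hodge
                          ((HodgeCM.Model.universeOf exists_isReal_hodgeModel_holds hodgePQ_independent_of_hodgeModel_holds (ballQuotientUniformisedDatum_of BallQuotient.ballQuotientUniformised_holds) (cmAbelianVarietyRealised_of_eigenbasis exists_isReal_hodgeModel_holds hodgePQ_independent_of_hodgeModel_holds cmAbelianVarietyEigenbasisRealised_holds)).pms F ι₁ V (j.1.conj h j.2)) 1).F 1).comap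
                    (HodgeCM.Model.TowerLevel.towerLevel exists_isReal_hodgeModel_holds hodgePQ_independent_of_hodgeModel_holds (ballQuotientUniformisedDatum_of BallQuotient.ballQuotientUniformised_holds) (cmAbelianVarietyRealised_of_eigenbasis exists_isReal_hodgeModel_holds hodgePQ_independent_of_hodgeModel_holds cmAbelianVarietyEigenbasisRealised_holds) Literature.NumberTheory.Transcendental.arapura2012_cor_15_4_6_holds j.1 j.2).subtype).map
                  (HodgeCM.Model.TowerCarrier.ofLevel exists_isReal_hodgeModel_holds hodgePQ_independent_of_hodgeModel_holds (ballQuotientUniformisedDatum_of BallQuotient.ballQuotientUniformised_holds) (cmAbelianVarietyRealised_of_eigenbasis exists_isReal_hodgeModel_holds hodgePQ_independent_of_hodgeModel_holds cmAbelianVarietyEigenbasisRealised_holds) Literature.NumberTheory.Transcendental.arapura2012_cor_15_4_6_holds j.1 j.2) :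
                Submodule ℂ ((datum413 hDel F V a₀ Φ i).HB τ')) →
              cB y = x → x = 0

set_option synthInstance.maxHeartbeats 400000 in
set_option maxHeartbeats 8000000 in
/-- STUB TYPE **T2c — EXTENDING A HOLOMORPHIC CLASS MAP TO `(1,0) ⊕ (0,1)` BY CONJUGATION** (M⁻; GENERIC — no pin, no tower): for every CM face
`(F, V)`, every `ℂ[U(V)(𝔸_{F⁺,f})]`-module `(H, ρ)`, every subspace `P ≤ H`, every INJECTIVE `ρ`-EQUIVARIANT `cls₁₀ : holCotForms 𝔞₀ → H` with values in `P`
and every INJECTIVE `ρ`-EQUIVARIANT CONJUGATE-LINEAR `cB : H → H` with `P ∩ cB P = 0`, there is an INJECTIVE `ρ`-EQUIVARIANT `cls : cohForms 𝔞₀ → H`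
(`cohForms 𝔞₀ = holCotForms 𝔞₀ ⊔ conjFun (holCotForms 𝔞₀)`, carriers §2).  Content: `cls (f + conjFun f') := cls₁₀ f + cB (cls₁₀ f')` (Mathlib `LinearPMap.sup`),
well defined because `holCotForms 𝔞₀ ⊓ conjFun (holCotForms 𝔞₀) = ⊥` (a function of right `K_∞`-type `weightOf x₀` AND of its conjugate type vanishes: the
central `U(1)` of `Stab_{U(2,1)}(x₀)` acts on the cotangent space by a non-real scalar — ★ `BallForms.cotangentCocycle`, ★ `weightForms`; [BorelWallach2000,
VII 2.10]), injective by `P ∩ cB P = 0` and the two injectivities, equivariant because `conjFun` commutes with `rightRep` (`rfl`) and `holCotForms 𝔞₀` is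
`rightRep`-stable (A-p13 `ArchFactor.IsHonest.rightRep_mem_holCotForms` with `archFactorOf_isHonest`, `Theorems/H413CohFormsCarriersLemmas` ∕ `P4StubT1ArchFactor`).
Why it might fail: it cannot once `hol ⊓ conj hol = ⊥` is proved for the cotangent `K_∞`-type; if `weightOf x₀` were REAL (it is not: it is the isotropy
character `e^{i(α−β)}` on `T*_{x₀}𝔹²`) the intersection could be non-zero.  (print: BorelWallach2000, VII 2.10 and 3.6) (print: Borel1997, §5.14) -/
def StubT2cCohClassMapOfHol : Prop :=
  ∀ (F : HodgeCM.CMField) {ι₁ : F →+* ℂ} (V : HodgeCM.HermSpace3 F ι₁) (H : Type) [AddCommGroup H] [Module ℂ H]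
      (ρ : Representation ℂ ↥(HodgeCM.HermSpace3.adelicFin V) H) (P : Submodule ℂ H)
      (cls₁₀ : ↥(holCotForms (archFactorOf F V)) →ₗ[ℂ] H),
      Function.Injective cls₁₀ →
        (∀ (g : ↥(HodgeCM.HermSpace3.adelicFin V)) (f : ↥(holCotForms (archFactorOf F V)))
            (hgf : rightRep F V g (f : _) ∈ holCotForms (archFactorOf F V)),
            cls₁₀ ⟨rightRep F V g (f : _), hgf⟩ = ρ g (cls₁₀ f)) →
          (∀ f : ↥(holCotForms (archFactorOf F V)), cls₁₀ f ∈ P) →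
            ∀ (cB : H →ₛₗ[starRingEnd ℂ] H), Function.Injective cB →
              (∀ (g : ↥(HodgeCM.HermSpace3.adelicFin V)) (x : H), cB (ρ g x) = ρ g (cB x)) →
                (∀ x y : H, x ∈ P → y ∈ P → cB y = x → x = 0) →
                  ∃ cls : ↥(cohForms (archFactorOf F V)) →ₗ[ℂ] H,
                    Function.Injective cls ∧
                      ∀ (g : ↥(HodgeCM.HermSpace3.adelicFin V)) (f : ↥(cohForms (archFactorOf F V)))
                        (hgf : rightRep F V g (f : _) ∈ cohForms (archFactorOf F V)),
                        cls ⟨rightRep F V g (f : _), hgf⟩ = ρ g (cls f)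

set_option synthInstance.maxHeartbeats 400000 in
set_option maxHeartbeats 8000000 in
/-- STUB TYPE **T3a — HOLOMORPHIC THETA REALISATION OF ONE `ι₁`-CLASS** (L; the theta road proper, = v2.1 T3 for the holomorphic Hodge type):
for every face, at `n = 3`, EITHER every weight-one admissible triple `t` with `ι₁ ∈ Φ_μ(t)`, OR every weight-one admissible triple with `ι₁ ∉ Φ_μ(t)`,
admits a NON-ZERO `U(V)(𝔸_{F⁺,f})`-EQUIVARIANT `ℂ`-linear map `θ_t : ω_V(t) → (U(V)(𝔸_{F⁺}) → ℂ²)` with values in the HOLOMORPHIC cotangent forms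
`holCotForms 𝔞₀` (the disjunction is over WHICH class is the holomorphic one — [Liu2021, Lem. D.2 (2)]: `(−1,−,0) ↔ π^{1,0}`, `(1,+,0) ↔ π^{0,1}` — so that no
sign convention of the tree's `cmType`/Weil representation is asserted).  Content («Conversely …», [Liu2021, l. 2145]): `θ_t(Φ_f) := ∫_{[U(W_t)]} Θ(φ_∞^{harm} ⊗ Φ_f)(g, h) χ(h) dh`,
the theta kernel of the pair `(U(W_t), U(V))` on the hermitian LINE of record of the class `ε` with splitting character `μ` ([Weil1964, n° 41 Thm. 6]
automorphy; [GelbartRogawski1991, §3 Prop. 3.1.1]); it is `χ`-covariant in the `U(W_t)`-variable hence FACTORS through the `χ`-coinvariants `ω_V(t)` (the pin's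
`omega t` IS `TwistedCoinv.Coinv …`; ★ `weilCoinvLift`, `weilCoinvLift_eq_zero_iff`); the HARMONIC archimedean vector of `K_∞`-type `(weightOf x₀)^∨` killed by `𝔭⁻`
exists exactly in the holomorphic class ([Liu2021, Lem. D.2 (2)] ⟸ [KonnoKonno2007, Thm. 5.4]); the Gaussian at the definite places is `K_c`-fixed ([Liu2021,
Lem. D.2 (1)]); smoothness/weight/hol-germ as in the model's ★ `ThetaDistDatum.dist_mem_weightForms` ∕ `isHolGerm_dist` ∕ `dist_ωf_V` ∕ `dist_ωf_W` (slots
`pinDatum{Zero…Three}G`); NON-VANISHING on `ω_V(t)` = Rallis inner product formula in the stable range ([Li1992, Thm. 2.1]; [Rallis1984]).  Why it might fail: as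
printed it cannot (l. 2145); at the pin only through the junction of the tree's `finPairRep … (hs a_t)` with a theta-distribution datum's `ωf` (reindexing
`FinSB`, scalar see-saw twist) — the L-sized work.  (print: Liu2021, proof of Prop. 4.13, l. 2145; App. D Lem. D.2 (1)(2)) (print: GelbartRogawski1991, §3 Prop. 3.1.1)
(print: Weil1964, n° 41 Thm. 6) (print: Li1992, Thm. 2.1) (print: KonnoKonno2007, Thm. 5.4) -/
def StubT3aHolThetaRealisationAt : Prop :=
  ∀ (hDel : Literature.AlgebraicGeometry.ShimuraVarieties.UnitaryCanonicalModel.canonicalModel_exists_printed)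
      (F : HodgeCM.CMField) [IsGalois ℚ F] (h6 : 6 ≤ Module.finrank ℚ F) {ι₁ : F →+* ℂ} (V : HodgeCM.HermSpace3 F ι₁) (a₀ : RealScalar F)
      (Φ : CMType F) (hΦ : ι₁ ∈ Φ.1) (i : (I V (repAt a₀) (muLiu ι₁ GramClass.rep))),
      (datum413 hDel F V a₀ Φ i).n = 3 →
        (∀ (t : (datum413 hDel F V a₀ Φ i).Triple), t.HasWeightOne → t.IsAdmissible → ι₁ ∈ t.cmType.1 →
            ∃ θ : (datum413 hDel F V a₀ Φ i).omega t.μ t.isConjugateSymplectic t.ε t.χ →ₗ[ℂ] ((adelicDatum F V).Adelic → (Fin 2 → ℂ)),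
              θ ≠ 0 ∧ (∀ v, θ v ∈ holCotForms (archFactorOf F V)) ∧
                ∀ (g : ↥(HodgeCM.HermSpace3.adelicFin V)) (v : (datum413 hDel F V a₀ Φ i).omega t.μ t.isConjugateSymplectic t.ε t.χ),
                  θ (rhoTriple (datum413 hDel F V a₀ Φ i) t g v) = rightRep F V g (θ v)) ∨
        (∀ (t : (datum413 hDel F V a₀ Φ i).Triple), t.HasWeightOne → t.IsAdmissible → ι₁ ∉ t.cmType.1 →
            ∃ θ : (datum413 hDel F V a₀ Φ i).omega t.μ t.isConjugateSymplectic t.ε t.χ →ₗ[ℂ] ((adelicDatum F V).Adelic → (Fin 2 → ℂ)),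
              θ ≠ 0 ∧ (∀ v, θ v ∈ holCotForms (archFactorOf F V)) ∧
                ∀ (g : ↥(HodgeCM.HermSpace3.adelicFin V)) (v : (datum413 hDel F V a₀ Φ i).omega t.μ t.isConjugateSymplectic t.ε t.χ),
                  θ (rhoTriple (datum413 hDel F V a₀ Φ i) t g v) = rightRep F V g (θ v))

set_option synthInstance.maxHeartbeats 400000 in
set_option maxHeartbeats 8000000 in
/-- STUB TYPE **T3a′ — HOLOMORPHIC THETA REALISATION OF ONE `ι₁`-CLASS, GIVEN RALLIS' INNER PRODUCT FORMULA** (L; ED. 1.1, director s341 «DEBT-FREE ROAD ∕ ONE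
CURRENCY WITH P2»): the statement of T3a (`StubT3aHolThetaRealisationAt`, body repeated verbatim after the arrow) UNDER the hypothesis
`Literature.NumberTheory.Li1992.RallisInnerProductFormulaUnitaryDualPair` — [Li1992, Thm. 2.1] restated over the tree's CONSTRUCTED unitary dual pair (★ p789496
`Literature/NumberTheory/Li1992/RallisInnerProductThetaLift.lean`, F0-typ3 (g0); the SHARED stub `stub_rallisInnerProductFormula` below carries it, token-identically for P2 and P4).
What is left in T3a′: the JUNCTION of the pin's `finPairRep … (hs a_t)` with a theta-kernel ∕ theta-distribution datum at the line `a_t` and the DESCENT through the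
`χ`-coinvariants (★ `weilCoinvLift`), the values in `holCotForms 𝔞₀` (harmonic archimedean vector, [Liu2021, Lem. D.2 (2)] ⟸ [KonnoKonno2007, Thm. 5.4]; model ★ `ThetaDistDatum.dist*`),
and NON-VANISHING from (26) by ★ `RallisInnerProductIdentity.thetaLift_ne_zero_of_re_pos` + LOCAL occupancy at every place (finite places: stable range `1 < 3`; archimedean: the
harmonic vector; the `U(1)(𝔸)`-integral of `⟨ω(h)Φ, Φ⟩ χ̄(h)` over the COMPACT group is a product of local norms of `χ_v`-isotypic projections, `> 0` for a suitable factorizable `Φ`).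
Why it might fail: as T3a (junction currency only).  (print: Liu2021, proof of Prop. 4.13, l. 2145; App. D Lem. D.2 (1)(2)) (print: Li1992, Thm. 2.1 (26) p. 184; p. 178)
(print: GelbartRogawski1991, §3 Prop. 3.1.1) (print: Weil1964, n° 41 Thm. 6) (print: KonnoKonno2007, Thm. 5.4)
ED. 3: the antecedent is the RANK-ONE SLICE `Li1992.RallisInnerProductFormulaUnitaryDualPairRankOne` (director s393 E2-1; ★ p797030) — weaker hypothesis, same conclusion.
ED. 3.1 ((A″), F0P4-plan (g3) ruling 2026-08-31T00:23Z on F0P4-p02 (g2)): the letter is `…UnitaryDualPairRankOneCont` = the rank-one slice + ONE coefficient-continuity binder «`∀ Φ₁ Φ₂, Continuous fun h => schwartzPairing … (pairRep … s (1,h) Φ₁) Φ₂`» [GR91 p. 454; Weil1964 n° 39], discharged at the pin by the ★ CM-splitting continuity; E-2 parent head = `E2RallisInnerProduct.rallisRankOneCont_holds`.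
ED. 3.3 (LETTER RULING «CM STRUCTURE BINDERS», F0P4-plan (g3) 2026-08-31T01:40Z, on F0P2a-p06 (g5) ∕ F0P2a-p08 (g4)): the letter is `…UnitaryDualPairRankOneContCM` = the ED. 2 §4 telescope + `[IsTotallyReal F] [IsTotallyComplex E] (τ : E →+* ℂ) (hτ : (JV.map τ).PosDef)` (★ `Li1992/RallisKernelIdentity` ED. 3 §5; bridge `rankOneContCM_of_rankOneCont`) — print՚s theorem restricted to CM quadratic extensions with `J_V` definite at one archimedean place, the only case the pin instantiates; the restriction is what lets Weil՚s closure of the Siegel–Weil child run without Hasse–Minkowski and without split-real-place majorants. -/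
def StubT3aHolThetaRealisationOfRallisAt : Prop :=
  Literature.NumberTheory.Li1992.RallisInnerProductFormulaUnitaryDualPairRankOneContCM →
  ∀ (hDel : Literature.AlgebraicGeometry.ShimuraVarieties.UnitaryCanonicalModel.canonicalModel_exists_printed)
      (F : HodgeCM.CMField) [IsGalois ℚ F] (h6 : 6 ≤ Module.finrank ℚ F) {ι₁ : F →+* ℂ} (V : HodgeCM.HermSpace3 F ι₁) (a₀ : RealScalar F)
      (Φ : CMType F) (hΦ : ι₁ ∈ Φ.1) (i : (I V (repAt a₀) (muLiu ι₁ GramClass.rep))),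
      (datum413 hDel F V a₀ Φ i).n = 3 →
        (∀ (t : (datum413 hDel F V a₀ Φ i).Triple), t.HasWeightOne → t.IsAdmissible → ι₁ ∈ t.cmType.1 →
            ∃ θ : (datum413 hDel F V a₀ Φ i).omega t.μ t.isConjugateSymplectic t.ε t.χ →ₗ[ℂ] ((adelicDatum F V).Adelic → (Fin 2 → ℂ)),
              θ ≠ 0 ∧ (∀ v, θ v ∈ holCotForms (archFactorOf F V)) ∧
                ∀ (g : ↥(HodgeCM.HermSpace3.adelicFin V)) (v : (datum413 hDel F V a₀ Φ i).omega t.μ t.isConjugateSymplectic t.ε t.χ),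
                  θ (rhoTriple (datum413 hDel F V a₀ Φ i) t g v) = rightRep F V g (θ v)) ∨
        (∀ (t : (datum413 hDel F V a₀ Φ i).Triple), t.HasWeightOne → t.IsAdmissible → ι₁ ∉ t.cmType.1 →
            ∃ θ : (datum413 hDel F V a₀ Φ i).omega t.μ t.isConjugateSymplectic t.ε t.χ →ₗ[ℂ] ((adelicDatum F V).Adelic → (Fin 2 → ℂ)),
              θ ≠ 0 ∧ (∀ v, θ v ∈ holCotForms (archFactorOf F V)) ∧
                ∀ (g : ↥(HodgeCM.HermSpace3.adelicFin V)) (v : (datum413 hDel F V a₀ Φ i).omega t.μ t.isConjugateSymplectic t.ε t.χ),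
                  θ (rhoTriple (datum413 hDel F V a₀ Φ i) t g v) = rightRep F V g (θ v))

set_option synthInstance.maxHeartbeats 400000 in
set_option maxHeartbeats 8000000 in
/-- STUB TYPE **T3a-LT — FINITE-ADÉLIC LINE TRANSPORT OF [Liu2021, Def. 4.11]'s CARRIER WITHIN A LOCAL NORM CLASS** (L; ED. 2, director s354 (4): the ONE
non-generic input of the theta road, PRICED AND REGISTERED; shared with programme P2 like T3n).  GENERIC over a CM field `L` (bundled ★ `CorCM.CMField`), a diagonal
frame `(e, dV)` of rank `3`, a unitary Hecke character `θ` of `L` whose restriction to `𝕀_{L⁺}` is `ε_{L/L⁺}` ([HarrisKudlaSweet1996, (1.5)]; ★ `IsSplittingChar L 1 θ`)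
and a character `χ ∈ Chi`: for two hermitian LINES `⟨a⟩`, `⟨a′⟩` (`a, a′ ∈ (L⁺)ˣ`) with the SAME local norm classes at every finite place (`locF a = locF a′` in
`Eps L⁺ δ²`, ★ `Def411WeilCarriers.locF`), the carriers `Ω(s_θ(a), χ)` and `Ω(s_θ(a′), χ)` of [Liu2021, Def. 4.11] AT THE TREE'S `θ`-SPLITTING FAMILY (★
`OmegaChiSplitting.hsChiD … θ …`, [GelbartRogawski1991, §3.1 Prop. 3.1.1]; ★ `Def411WeilCarriersAtLine.omegaAtLine`) are ISOMORPHIC, `U(diag dV)(𝔸_{L⁺,f})`-EQUIVARIANTLY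
for `rhoVAtLine`, ON THE NOSE (same `χ`, identity on the group).  This is the promise of ★ `Def411WeilCarriersAtLine`'s docstring («another representative differs by a global
element that is a local norm everywhere and gives an isomorphic …»): the pin's `ω_V(t)` sits at the representative `r_{a₀,i}(t.ε)` (`pinRep` below), the theta forms at the
ADMISSIBLE line `a_e` (★ `AdmissibleLine.exists_admissibleLine`), and `a_e ∕ r(t.ε)` is a local norm at every FINITE place but in general NOT totally positive, so no rational
isometry `⟨r(t.ε)⟩ ≅ ⟨a_e⟩` exists and the rational frame transport ★ `chiSplittingFrameTransport_holds` does not apply.  ROAD (G) (A-p17 (g12) census §2, §4): one adèlic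
metaplectic group after a Lagrangian-preserving relabel (★ `AdelicMetaplecticTransport`, `adelicSp_smul`); the adèlic similitude `m_z` by a finite idèle `z` of `L` with
`N z = a′∕a` ((LT-1): surjectivity of the local unit norm at unramified inert places + ★ `mem_quadraticNormSubgroup_iff` at split places); an implementer over it (★
`adelicMpCont.proj_surjective`); the two lifts `U(⟨a⟩) × U(V) → Mp` differ by a continuous character `η` of the pair (★ `isCentralExt`); `η = 1` from the naturality of the
doubling `θ`-splitting ((LT-3) = (G4), PER PLACE — [Kudla1994, §1–2], [HarrisKudlaSweet1996, §1]; HD3's converse direction ★ `exists_conj_eq_of_lineTransportSplitting_eq` is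
the same currency); descent to the `χ`-coinvariants (★ `exists_coinv_equiv_weilCoinv`, `coinvLineCenterEquiv`, `exists_omegaAtLine_equiv_rhoVAtLine_of_finPairRep_conj`).
Why it might fail: only at (LT-3) — if the tree's `chiSplittingLine` depended on the representative `a` beyond its local isometry class, the two lifts would differ by
`η = (η_V, η_W) ≠ 1` and the true letter would carry `χ′ = η_W·χ` on the right and a twist by `η_V` on the group (T3a″ is uniform in `χ`, so the line would survive a
re-lettering; report-first).  Size L ≈ 600–900 l. ∕ 3 files.  (print: Liu2021, Def. 4.11 (ll. 2092–2096); App. D §D.1 Steps 2–3 (ll. 5217–5221))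
(print: GelbartRogawski1991, §3.1 Prop. 3.1.1 p. 455; Remark p. 457) (print: HarrisKudlaSweet1996, §1 (1.5) p. 951) (print: Kudla1994, §1–2) (print: Weil1964, n° 37 p. 188)
(print: MoeglinVignerasWaldspurger1987, Chap. 3 I.1–I.3) -/
def StubT3aLineTransportAt : Prop :=
  ∀ (L : Summit.HodgeConjecture.CorCM.CMField) {n : ℕ} (e : Fin 3 × Fin 1 ≃ Fin n) (dV : Fin 3 → L)
      (hdV : ∀ j, IsCMField.complexConj L (dV j) = dV j) (hdV0 : ∀ j, dV j ≠ 0)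
      (θ : Literature.NumberTheory.GaloisRepresentations.HeckeCharacter L) (hθu : θ.IsUnitary)
      (hθs : Literature.RepresentationTheory.HarrisKudlaSweet1996.IsSplittingChar L 1 θ)
      (a a' : (↥(maximalRealSubfield L))ˣ) (χ : Def411WeilCarriers.Chi ↥(maximalRealSubfield L) L (IsCMField.complexConj L)),
      locF ↥(maximalRealSubfield L) (imagUnitSq L) a = locF ↥(maximalRealSubfield L) (imagUnitSq L) a' →
        ∃ Ψ : Def411WeilCarriers.omegaAtLine ↥(maximalRealSubfield L) L (IsCMField.complexConj L) 3 e (Matrix.diagonal dV)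
              (complexConj_imagUnit L) (imagUnit_ne_zero L) (imagUnit_mul_self L) (realDiagonal_isSymm L dV hdV)
              (isUnit_det_realDiagonal L dV hdV hdV0) (realDiagonal_map L dV hdV).symm (OmegaChiSplitting.hsChiD L e dV hdV hdV0 θ hθu hθs)
              a χ ≃ₗ[ℂ]
            Def411WeilCarriers.omegaAtLine ↥(maximalRealSubfield L) L (IsCMField.complexConj L) 3 e (Matrix.diagonal dV)
              (complexConj_imagUnit L) (imagUnit_ne_zero L) (imagUnit_mul_self L) (realDiagonal_isSymm L dV hdV)
              (isUnit_det_realDiagonal L dV hdV hdV0) (realDiagonal_map L dV hdV).symm (OmegaChiSplitting.hsChiD L e dV hdV hdV0 θ hθu hθs)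
              a' χ,
          ∀ (k : ↥(UnitaryGroup.finAdelic ↥(maximalRealSubfield L) L (IsCMField.complexConj L) 3 (Matrix.diagonal dV)))
            (x : Def411WeilCarriers.omegaAtLine ↥(maximalRealSubfield L) L (IsCMField.complexConj L) 3 e (Matrix.diagonal dV)
              (complexConj_imagUnit L) (imagUnit_ne_zero L) (imagUnit_mul_self L) (realDiagonal_isSymm L dV hdV)
              (isUnit_det_realDiagonal L dV hdV hdV0) (realDiagonal_map L dV hdV).symm (OmegaChiSplitting.hsChiD L e dV hdV hdV0 θ hθu hθs)
              a χ),
            Ψ (Def411WeilCarriers.rhoVAtLine ↥(maximalRealSubfield L) L (IsCMField.complexConj L) 3 e (Matrix.diagonal dV)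
                (complexConj_imagUnit L) (imagUnit_ne_zero L) (imagUnit_mul_self L) (realDiagonal_isSymm L dV hdV)
                (isUnit_det_realDiagonal L dV hdV hdV0) (realDiagonal_map L dV hdV).symm (OmegaChiSplitting.hsChiD L e dV hdV hdV0 θ hθu hθs)
                a χ k x) =
              Def411WeilCarriers.rhoVAtLine ↥(maximalRealSubfield L) L (IsCMField.complexConj L) 3 e (Matrix.diagonal dV)
                (complexConj_imagUnit L) (imagUnit_ne_zero L) (imagUnit_mul_self L) (realDiagonal_isSymm L dV hdV)
                (isUnit_det_realDiagonal L dV hdV hdV0) (realDiagonal_map L dV hdV).symm (OmegaChiSplitting.hsChiD L e dV hdV hdV0 θ hθu hθs)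
                a' χ k (Ψ x)

set_option synthInstance.maxHeartbeats 400000 in
set_option maxHeartbeats 8000000 in
/-- STUB TYPE **T3a″ — HOLOMORPHIC THETA REALISATION AT THE ADMISSIBLE LINE, GIVEN RALLIS' INNER PRODUCT FORMULA** (L; ED. 2 = T3a′ with the line transport FACTORED
OUT: `stub_T3a_holThetaRealisationOfRallisAt` is the theorem `stubT3aOfRallis_of` of T3a-LT and this).  For every face prefix, at `n = 3`, for every weight-one admissible
triple `t = (μ, ε, χ)` of the `ι₁`-class `ι₁ ∈ Φ_μ` (DISJUNCT A of the node, decided: `(mk ι₁).embedding = ι₁` from the binder `i` by ★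
`IndexOrientation.embedding_mk_eq_of_indexOfRecord`, so the positive-slot sign of the admissible line at `ι₁` is exactly `ι₁ ∈ Φ_μ`, ★ `AdmissibleLine.exists_admissibleLine_hpos_iff`),
and for every ADMISSIBLE LINE of `t` — a witness `e ∈ L^{×−}` of [Liu2021, Def. 4.12] (`IsAdmissibleElement L Φ_μ e`) and the global real unit `a = e·2δ ∈ (L⁺)ˣ` with
`locF a = t.ε` (★ `AdmissibleLine.exists_admissibleLine` PRODUCES them; they are binders here so the closer never chooses) — there is a NON-ZERO `ℂ`-linear map `θ` from
[Liu2021, Def. 4.11]'s carrier AT THE LINE `⟨a⟩` (★ `Def411WeilCarriersAtLine.omegaAtLine` at the pin's frame `(e₁, frameD V)` and the `μ`-splitting family ★ `hsChiD …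
(toHeckeCharacter μ) …` — the SAME term as the pin's `ω_V(t)` (★ `uniformOmegaRep` inside ★ `datum413`) with the representative `r_{a₀,i}(t.ε)` replaced by `a`) to
`U(V)(𝔸_{L⁺}) → ℂ²`, with values in the HOLOMORPHIC cotangent forms `holCotForms 𝔞₀` and `U(V)(𝔸_{L⁺,f})`-equivariant through the frame transport of record ★ `ιVE V`
(`rhoVAtLine … (ιVE V g)`).  Content = [Liu2021, proof of Prop. 4.13, l. 2145 «Conversely …»] at a GOOD representative: the JUNCTION of the pin's `finPairRep … (hsChiD … a)`
with the theta-kernel ∕ theta-distribution datum of the pair `(U(⟨a⟩), U(V))` (p01's J: ★ `Weil1964/ThetaLiftTransport`, ★ `ThetaLiftTransportMap`, ★ `H413WeilCoinvTwinBridge`;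
model ★ `ThetaDistDatum.dist` ∕ `dist_ωf_V` ∕ `dist_ωf_W` ∕ `dist_mem_weightForms` ∕ `isHolGerm_dist`; ★ `weilCoinvLift` ∕ `weilCoinvLift_eq_zero_iff`), DESCENT through the
`χ`-coinvariants, HOLOMORPHY from the harmonic archimedean vector at the admissible signs ([Liu2021, Lem. D.2 (2)] ⟸ [KonnoKonno2007, Thm. 5.4]; ★
`H413HolCotFormsOfModel.funLeft_latticeEquiv_mem_holCotForms`), NON-VANISHING from Rallis' formula (the antecedent; ★ `RallisInnerProductIdentity.thetaLift_charCM_ne_zero_of_fourierCoeff_ne_zero`,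
head of ★ p792361 `Li1992/ThetaLiftCharacterArchFinReduction` `thetaLift_charCM_tmul_ne_zero_of_finCoeff_ne_zero`) + local occupancy at every place ((J2) `hω`, (χ) `hχw`,
(A) `heig`∕`hΦΨ`, (FIN) `hfin` of F0P4-p02's SEAT-(ii) MEMO v1 §1).  Why it might fail: as T3a′ minus the transport — junction currency only ((J2): the pin's finite Weil
representation `pairRep s (1,h)` vs the theta datum's `ωfin` through `piSBReindex`; (FIN): the Euler exchange over `Π′_v U(⟨a⟩)(L⁺_v)`).  (print: Liu2021, proof of Prop. 4.13,
l. 2145; Def. 4.12 (ll. 2102–2108); App. D Lem. D.2 (1)(2)) (print: Li1992, Thm. 2.1 (26) p. 184) (print: GelbartRogawski1991, §3 Prop. 3.1.1) (print: Weil1964, n° 41 Thm. 6)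
(print: KonnoKonno2007, Thm. 5.4)
ED. 3: the antecedent is the RANK-ONE SLICE `Li1992.RallisInnerProductFormulaUnitaryDualPairRankOne` (director s393 E2-1; ★ p797030) — weaker hypothesis, same conclusion.
ED. 3.1 ((A″), F0P4-plan (g3) ruling 2026-08-31T00:23Z on F0P4-p02 (g2)): the letter is `…UnitaryDualPairRankOneCont` = the rank-one slice + ONE coefficient-continuity binder «`∀ Φ₁ Φ₂, Continuous fun h => schwartzPairing … (pairRep … s (1,h) Φ₁) Φ₂`» [GR91 p. 454; Weil1964 n° 39], discharged at the pin by the ★ CM-splitting continuity; E-2 parent head = `E2RallisInnerProduct.rallisRankOneCont_holds`.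
ED. 3.3 (LETTER RULING «CM STRUCTURE BINDERS», F0P4-plan (g3) 2026-08-31T01:40Z, on F0P2a-p06 (g5) ∕ F0P2a-p08 (g4)): the letter is `…UnitaryDualPairRankOneContCM` = the ED. 2 §4 telescope + `[IsTotallyReal F] [IsTotallyComplex E] (τ : E →+* ℂ) (hτ : (JV.map τ).PosDef)` (★ `Li1992/RallisKernelIdentity` ED. 3 §5; bridge `rankOneContCM_of_rankOneCont`) — print՚s theorem restricted to CM quadratic extensions with `J_V` definite at one archimedean place, the only case the pin instantiates; the restriction is what lets Weil՚s closure of the Siegel–Weil child run without Hasse–Minkowski and without split-real-place majorants. -/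
def StubT3aHolThetaAtAdmissibleLineOfRallisAt : Prop :=
  Literature.NumberTheory.Li1992.RallisInnerProductFormulaUnitaryDualPairRankOneContCM →
  ∀ (hDel : Literature.AlgebraicGeometry.ShimuraVarieties.UnitaryCanonicalModel.canonicalModel_exists_printed)
      (F : HodgeCM.CMField) [IsGalois ℚ F] (h6 : 6 ≤ Module.finrank ℚ F) {ι₁ : F →+* ℂ} (V : HodgeCM.HermSpace3 F ι₁) (a₀ : RealScalar F)
      (Φ : CMType F) (hΦ : ι₁ ∈ Φ.1) (i : (I V (repAt a₀) (muLiu ι₁ GramClass.rep))),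
      (datum413 hDel F V a₀ Φ i).n = 3 →
        ∀ (t : (datum413 hDel F V a₀ Φ i).Triple), t.HasWeightOne → t.IsAdmissible → ι₁ ∈ t.cmType.1 →
          ∀ (e : HodgeCM.CMField.K F) (a : (↥(maximalRealSubfield (HodgeCM.CMField.K F)))ˣ),
            Literature.AlgebraicGeometry.Liu2021.IsAdmissibleElement (HodgeCM.CMField.K F) t.cmType.1 e →
            locF ↥(maximalRealSubfield (HodgeCM.CMField.K F)) (imagUnitSq (HodgeCM.CMField.K F)) a = t.ε →
            ((a : ↥(maximalRealSubfield (HodgeCM.CMField.K F))) : HodgeCM.CMField.K F) = e * (2 * imagUnit (HodgeCM.CMField.K F)) →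
              ∃ θ : Def411WeilCarriers.omegaAtLine ↥(maximalRealSubfield (HodgeCM.CMField.K F)) (HodgeCM.CMField.K F)
                    (IsCMField.complexConj (HodgeCM.CMField.K F)) 3 e₁ (Matrix.diagonal (frameD V)) (complexConj_imagUnit (HodgeCM.CMField.K F))
                    (imagUnit_ne_zero (HodgeCM.CMField.K F)) (imagUnit_mul_self (HodgeCM.CMField.K F))
                    (realDiagonal_isSymm (HodgeCM.CMField.K F) (frameD V) (frameD_real V))
                    (isUnit_det_realDiagonal (HodgeCM.CMField.K F) (frameD V) (frameD_real V) (frameD_ne V))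
                    (realDiagonal_map (HodgeCM.CMField.K F) (frameD V) (frameD_real V)).symm
                    (OmegaChiSplitting.hsChiD ⟨HodgeCM.CMField.K F⟩ e₁ (frameD V) (frameD_real V) (frameD_ne V)
                      (Literature.NumberTheory.Automorphic.IdeleClassGroup.toHeckeCharacter (HodgeCM.CMField.K F) t.μ)
                      (Literature.NumberTheory.Automorphic.IdeleClassGroup.isUnitary_toHeckeCharacter (HodgeCM.CMField.K F) t.μ)
                      ((Literature.RepresentationTheory.Liu2021.isOscillatorChar_toHeckeCharacter_iff t.μ).mpr t.isConjugateSymplectic))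
                    a t.χ →ₗ[ℂ] ((adelicDatum F V).Adelic → (Fin 2 → ℂ)),
                θ ≠ 0 ∧ (∀ w, θ w ∈ holCotForms (archFactorOf F V)) ∧
                  ∀ (g : ↥(HodgeCM.HermSpace3.adelicFin V))
                    (w : Def411WeilCarriers.omegaAtLine ↥(maximalRealSubfield (HodgeCM.CMField.K F)) (HodgeCM.CMField.K F)
                    (IsCMField.complexConj (HodgeCM.CMField.K F)) 3 e₁ (Matrix.diagonal (frameD V)) (complexConj_imagUnit (HodgeCM.CMField.K F))
                    (imagUnit_ne_zero (HodgeCM.CMField.K F)) (imagUnit_mul_self (HodgeCM.CMField.K F))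
                    (realDiagonal_isSymm (HodgeCM.CMField.K F) (frameD V) (frameD_real V))
                    (isUnit_det_realDiagonal (HodgeCM.CMField.K F) (frameD V) (frameD_real V) (frameD_ne V))
                    (realDiagonal_map (HodgeCM.CMField.K F) (frameD V) (frameD_real V)).symm
                    (OmegaChiSplitting.hsChiD ⟨HodgeCM.CMField.K F⟩ e₁ (frameD V) (frameD_real V) (frameD_ne V)
                      (Literature.NumberTheory.Automorphic.IdeleClassGroup.toHeckeCharacter (HodgeCM.CMField.K F) t.μ)
                      (Literature.NumberTheory.Automorphic.IdeleClassGroup.isUnitary_toHeckeCharacter (HodgeCM.CMField.K F) t.μ)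
                      ((Literature.RepresentationTheory.Liu2021.isOscillatorChar_toHeckeCharacter_iff t.μ).mpr t.isConjugateSymplectic))
                    a t.χ),
                    θ (Def411WeilCarriers.rhoVAtLine ↥(maximalRealSubfield (HodgeCM.CMField.K F)) (HodgeCM.CMField.K F)
                      (IsCMField.complexConj (HodgeCM.CMField.K F)) 3 e₁ (Matrix.diagonal (frameD V)) (complexConj_imagUnit (HodgeCM.CMField.K F))
                      (imagUnit_ne_zero (HodgeCM.CMField.K F)) (imagUnit_mul_self (HodgeCM.CMField.K F))
                      (realDiagonal_isSymm (HodgeCM.CMField.K F) (frameD V) (frameD_real V))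
                      (isUnit_det_realDiagonal (HodgeCM.CMField.K F) (frameD V) (frameD_real V) (frameD_ne V))
                      (realDiagonal_map (HodgeCM.CMField.K F) (frameD V) (frameD_real V)).symm
                      (OmegaChiSplitting.hsChiD ⟨HodgeCM.CMField.K F⟩ e₁ (frameD V) (frameD_real V) (frameD_ne V)
                        (Literature.NumberTheory.Automorphic.IdeleClassGroup.toHeckeCharacter (HodgeCM.CMField.K F) t.μ)
                        (Literature.NumberTheory.Automorphic.IdeleClassGroup.isUnitary_toHeckeCharacter (HodgeCM.CMField.K F) t.μ)
                        ((Literature.RepresentationTheory.Liu2021.isOscillatorChar_toHeckeCharacter_iff t.μ).mpr t.isConjugateSymplectic))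
                      a t.χ (ιVE V g) w) = rightRep F V g (θ w)

set_option synthInstance.maxHeartbeats 400000 in
set_option maxHeartbeats 8000000 in
/-- STUB TYPE **T3b — THE WEIGHT-ONE ADMISSIBLE FAMILY IS CLOSED UNDER COMPLEX CONJUGATION, FLIPPING THE `ι₁`-CLASS** (M): for every face, at `n = 3`,
every weight-one admissible triple `t = (μ, ε, χ)` has a weight-one admissible PARTNER `t' = (μ', ε', χ')` with `ι₁ ∈ Φ_{μ'} ↔ ι₁ ∉ Φ_μ` and a CONJUGATE-LINEAR
BIJECTION `J : ω_V(t) → ω_V(t')` intertwining `rho t` and `rho t'` (i.e. `ω_V(t') ≅ \overline{ω_V(t)}`).  Content: `μ' = μ ∘ c` (again conjugate symplectic of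
weight one, `Φ_{μ∘c} = Φ_μ ∘ c` = the complementary CM type, so the `ι₁`-class flips), `ε' =` the classes of `−e` (`−e ∈ E^{×−}` is `μ'`-admissible:
`Im τ̄'(−e) … < 0` for `τ̄' ∈ Φ_μ ∘ c` iff `Im τ'(e) < 0` for `τ' ∈ Φ_μ`), `χ' = χ̄ = χ⁻¹`; `J` = complex conjugation of finite Schwartz functions `φ ↦ φ̄`, which
intertwines the Weil representation `ω_ψ` on the line `a` with `ω_{ψ̄} = ω_ψ` on the line `−a` and conjugated splitting data, and the character `χ` with `χ̄`,
hence descends to the `χ`- and `χ̄`-coinvariants ([Liu2021, Def. 4.11, Lem. D.1]; [GelbartRogawski1991, §3 Prop. 3.1.1]; [Weil1964, n° 37–41]; the pin's `omega` =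
★ `TwistedCoinv.Coinv (finPairRepW …) (lineChar …)`, ★ `Def411WeilCarriersAtLine` §1).  Why it might fail: only if the pin's carrier `P.Eps` of classes were not
closed under `e ↦ −e` or `P.Chi` under inversion (both are: `epsOf` is total on `E`, `Chi` = all characters of the finite norm-one idèle classes) — else a
bookkeeping of the tree's `finPairRep` conjugation formula.  (print: Liu2021, Def. 4.11–4.12; App. D Lem. D.1) (print: GelbartRogawski1991, §3 Prop. 3.1.1)
(print: Weil1964, n° 37–41) -/
def StubT3bConjugatePartnerAt : Prop :=
  ∀ (hDel : Literature.AlgebraicGeometry.ShimuraVarieties.UnitaryCanonicalModel.canonicalModel_exists_printed)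
      (F : HodgeCM.CMField) [IsGalois ℚ F] (h6 : 6 ≤ Module.finrank ℚ F) {ι₁ : F →+* ℂ} (V : HodgeCM.HermSpace3 F ι₁) (a₀ : RealScalar F)
      (Φ : CMType F) (hΦ : ι₁ ∈ Φ.1) (i : (I V (repAt a₀) (muLiu ι₁ GramClass.rep))),
      (datum413 hDel F V a₀ Φ i).n = 3 →
        ∀ (t : (datum413 hDel F V a₀ Φ i).Triple), t.HasWeightOne → t.IsAdmissible →
          ∃ t' : (datum413 hDel F V a₀ Φ i).Triple, t'.HasWeightOne ∧ t'.IsAdmissible ∧ (ι₁ ∈ t'.cmType.1 ↔ ι₁ ∉ t.cmType.1) ∧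
            ∃ J : (datum413 hDel F V a₀ Φ i).omega t.μ t.isConjugateSymplectic t.ε t.χ →ₛₗ[starRingEnd ℂ]
                (datum413 hDel F V a₀ Φ i).omega t'.μ t'.isConjugateSymplectic t'.ε t'.χ,
              Function.Bijective J ∧
                ∀ (g : ↥(HodgeCM.HermSpace3.adelicFin V)) (v : (datum413 hDel F V a₀ Φ i).omega t.μ t.isConjugateSymplectic t.ε t.χ),
                  J (rhoTriple (datum413 hDel F V a₀ Φ i) t g v) = rhoTriple (datum413 hDel F V a₀ Φ i) t' g (J v)

/-- **`stub_T2a_holClassMapAt`** — REGISTERED STUB T2a (M): the injective equivariant holomorphic class map with `(1,0)` range (`StubT2aHolClassMapAt`).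
STAFF FIRST (A-p13 (g21) has the levelwise and tower pieces). [cite: BorelWallach2000, VII 3.2, VII 3.6, XIII 1.2] [cite: VoisinHodgeI2002, Cor. 7.6]
ED. 1.2 (registrar A-plan1 (g17), director s347 BY-NAME FOLD): CLOSED by ★ p790124 `Theorems/H413CuspCotPin.lean` ::
`Summit.HodgeConjecture.HodgeConjecture.Cruxes.H413.CuspCot.t2a_holClassMapAt` (A-p13 (g21); type = this stub's body verbatim) — no `sorry` here any more. -/
theorem stub_T2a_holClassMapAt : StubT2aHolClassMapAt :=
  Summit.HodgeConjecture.HodgeConjecture.Cruxes.H413.CuspCot.t2a_holClassMapAt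

/-- **`stub_T2b_towerConjugationAt`** — REGISTERED STUB T2b (M): complex conjugation on the pin's tower module, Hodge-disjoint from the `(1,0)`-part
(`StubT2bTowerConjugationAt`). [cite: VoisinHodgeI2002, §7.1] [cite: DeligneHodgeII1971, 1.2.5]
ED. 1.4 (registrar A-plan1 (g17), director s347 BY-NAME FOLD): CLOSED by ★ p791878 `Theorems/H413TowerConjPin.lean` ::
`Summit.HodgeConjecture.HodgeConjecture.Cruxes.H413.TowerConj.towerConjugationAt_pin` (A-p19 (g15); type = this stub's body verbatim; FILE A ★ p791712 `Theorems/H413TowerConj.lean`) — no `sorry` here any more. -/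
theorem stub_T2b_towerConjugationAt : StubT2bTowerConjugationAt :=
  Summit.HodgeConjecture.HodgeConjecture.Cruxes.H413.TowerConj.towerConjugationAt_pin

/-- **`stub_T2c_cohClassMapOfHol`** — REGISTERED STUB T2c (M⁻, generic): extension of a holomorphic class map to `hol ⊔ conj hol` along a Hodge-disjoint
conjugation (`StubT2cCohClassMapOfHol`). [cite: BorelWallach2000, VII 2.10 and 3.6]
ED. 1.3 (registrar A-plan1 (g17), director s347 BY-NAME FOLD): CLOSED by ★ p791720 `Theorems/P4StubT2cCohClassMapOfHol.lean` ::
`Summit.HodgeConjecture.HodgeConjecture.Cruxes.H413.P4StubT2cCohClassMapOfHol.stubT2cCohClassMapOfHol_holds` (A-p08 (g15); type = this stub's body verbatim) — no `sorry` here any more. -/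
theorem stub_T2c_cohClassMapOfHol : StubT2cCohClassMapOfHol :=
  Summit.HodgeConjecture.HodgeConjecture.Cruxes.H413.P4StubT2cCohClassMapOfHol.stubT2cCohClassMapOfHol_holds

/-- **`stub_rallisInnerProductFormula`** — REGISTERED STUB T3n (XL as a proof, a THEOREM in print; ED. 1.1, director s341: the SHARED P2∕P4 stub, ONE currency, debt-free —
a stub to be PROVED, never a hypothesis of a closing file): [Li1992, Thm. 2.1] Rallis' inner product formula in Weil's convergent range for the tree's constructed unitary
dual pair, i.e. the named statement `Literature.NumberTheory.Li1992.RallisInnerProductFormulaUnitaryDualPair` of ★ p789496 VERBATIM as the stub's type (so P2's sub-line «F0-P2CohSpectrumL2» and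
this line register ONE item by normalised signature). [cite: Li1992, Thm 2.1 (26) p. 184] [cite: Weil1964, n° 41 Thm. 6] [cite: GelbartRogawski1991, §3 Prop. 3.1.1]
ED. 3: the stub's TYPE is the RANK-ONE SLICE `Li1992.RallisInnerProductFormulaUnitaryDualPairRankOne` (director s393 E2-1; ★ p797030 :143 = the general statement at `M := 1`, `2 < N`, + four structure binders); closer = ENGINE E-2 head `E2RallisInnerProduct.rallisRankOne_holds` (`Cruxes/H413/Lines/F0_E2RallisInnerProduct.lean`).
ED. 3.1 ((A″), F0P4-plan (g3) ruling 2026-08-31T00:23Z on F0P4-p02 (g2)): the letter is `…UnitaryDualPairRankOneCont` = the rank-one slice + ONE coefficient-continuity binder «`∀ Φ₁ Φ₂, Continuous fun h => schwartzPairing … (pairRep … s (1,h) Φ₁) Φ₂`» [GR91 p. 454; Weil1964 n° 39], discharged at the pin by the ★ CM-splitting continuity; E-2 parent head = `E2RallisInnerProduct.rallisRankOneCont_holds`.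
ED. 3.3 (LETTER RULING «CM STRUCTURE BINDERS», F0P4-plan (g3) 2026-08-31T01:40Z, on F0P2a-p06 (g5) ∕ F0P2a-p08 (g4)): the letter is `…UnitaryDualPairRankOneContCM` = the ED. 2 §4 telescope + `[IsTotallyReal F] [IsTotallyComplex E] (τ : E →+* ℂ) (hτ : (JV.map τ).PosDef)` (★ `Li1992/RallisKernelIdentity` ED. 3 §5; bridge `rankOneContCM_of_rankOneCont`) — print՚s theorem restricted to CM quadratic extensions with `J_V` definite at one archimedean place, the only case the pin instantiates; the restriction is what lets Weil՚s closure of the Siegel–Weil child run without Hasse–Minkowski and without split-real-place majorants.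
ED. 4 (S6 FOLD BY NAME, F0P4-plan (g4) recipe of record 2026-08-31T04:17Z): CLOSED — ★ p810320 `Theorems/H413E2RallisRankOneOfKernel.lean :: …Cruxes.H413.E2RallisRankOne.rallisRankOneContCM_of_kernelCM`
(A-p17 (g14); the E-2 parent composition at `Theorems/`) ∘ ★ p810576 `Theorems/H413E2SWKernelRallisOfSiegelWeil.lean :: …Cruxes.H413.E2SiegelWeil.kernelRallisIdentityCM_of_siegelWeil` (A-p17 (g14); the E-2 child
composition at `Theorems/`) applied to ★ p814040 `H413E2SWSiegelWeilCMClosed.lean :: Summit.HodgeConjecture.HodgeConjecture.Cruxes.H413.E2SWSiegelWeilCM.siegelWeil_weilRange_CM` (the Siegel–Weil formula in Weil՚s convergent range for the doubled CM pair = the `hSW` binder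
of ★ p810576 VERBATIM; BOUND = Lemme 20 assembly, I-CLOSE = identity-close assembly) — no `sorry` here any more; open stubs → ∅. HC_CM is proved only modulo the printed citations until rung 0 closes. -/
theorem stub_rallisInnerProductFormula : Literature.NumberTheory.Li1992.RallisInnerProductFormulaUnitaryDualPairRankOneContCM :=
  Summit.HodgeConjecture.HodgeConjecture.Cruxes.H413.E2RallisRankOne.rallisRankOneContCM_of_kernelCM
    (Summit.HodgeConjecture.HodgeConjecture.Cruxes.H413.E2SiegelWeil.kernelRallisIdentityCM_of_siegelWeil
      Summit.HodgeConjecture.HodgeConjecture.Cruxes.H413.E2SWSiegelWeilCM.siegelWeil_weilRange_CM)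

/-- **`stub_T3a_lineTransportAt`** — REGISTERED STUB T3a-LT (L; ED. 2, director s354 (4)): finite-adélic line transport of [Liu2021, Def. 4.11]'s carrier within a local norm
class, generic (`StubT3aLineTransportAt`); road (G), A-p17 (g12) — (LT-1) report-first, then (G2)→(G5); shared with programme P2.
[cite: Liu2021, Def. 4.11; App. D §D.1] [cite: GelbartRogawski1991, §3.1 Prop. 3.1.1] [cite: HarrisKudlaSweet1996, §1 (1.5)] [cite: Kudla1994, §1–2]
ED. 2.1 (BY-NAME FOLD): CLOSED by ★ `Theorems/H413LineTransportAllFrames.lean` :: `Summit.HodgeConjecture.HodgeConjecture.Cruxes.H413.LineTransport.lineTransportAt`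
(A-p17 (g13); type = this stub's body verbatim) — no `sorry` here any more. -/
theorem stub_T3a_lineTransportAt : StubT3aLineTransportAt :=
  Summit.HodgeConjecture.HodgeConjecture.Cruxes.H413.LineTransport.lineTransportAt

/-- **`stub_T3a_holThetaAtAdmissibleLineOfRallisAt`** — REGISTERED STUB T3a″ (L; ED. 2): holomorphic theta realisation of the class `ι₁ ∈ Φ_μ` AT THE ADMISSIBLE LINE, given
Rallis' formula (`StubT3aHolThetaAtAdmissibleLineOfRallisAt`); F0P4-p01 (junction J), p02 ((χ) + (26)-assembly), p05 (J-R), p07 (A), p08 (F4); STAFF FIRST with T3a-LT.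
[cite: Liu2021, proof of Prop. 4.13, l. 2145; Lem. D.2] [cite: Weil1964, n° 41 Thm. 6] [cite: Li1992, Thm. 2.1] [cite: KonnoKonno2007, Thm. 5.4]
ED. 3.4 (S4b FOLD BY NAME, F0P4-plan (g4) PLAN v4 §2): CLOSED — ★ p803540 `Theorems/H413HolThetaAtAdmissibleLineFold.lean :: …Cruxes.H413.ThetaJunction.holThetaAtAdmissibleLine_fold`
(F0P4-p01 (g2); `(chiN : R → …) : R → <this letter՚s body>`) applied to ★ p810753 `H413ChiNRowAtPin.lean :: Summit.HodgeConjecture.HodgeConjecture.Cruxes.H413.RallisTransport.chiN_of_rankOneContCM`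
(F0P4-p05 (g2): the `χ^N`-row at the pin from the CM Rallis letter `R := Li1992.RallisInnerProductFormulaUnitaryDualPairRankOneContCM` via FILE 2 ★ p809868 `Theorems/H413RallisIdentityAtPin` (p04 (g3)), pin lemma ★ p801549, hF-pin ★ p808736, FILE 1′ ★ p808735, A-PIN ★ p803178, FIN-PIN ★ p803173) — no `sorry` here any more;
open stubs → EXACTLY ONE {S6 `stub_rallisInnerProductFormula` = ENGINE E-2}. -/
theorem stub_T3a_holThetaAtAdmissibleLineOfRallisAt : StubT3aHolThetaAtAdmissibleLineOfRallisAt :=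
  Summit.HodgeConjecture.HodgeConjecture.Cruxes.H413.ThetaJunction.holThetaAtAdmissibleLine_fold
    Summit.HodgeConjecture.HodgeConjecture.Cruxes.H413.RallisTransport.chiN_of_rankOneContCM

/-- **`stub_T3b_conjugatePartnerAt`** — REGISTERED STUB T3b (M): conjugation symmetry of the weight-one admissible family with the `ι₁`-class flipped
(`StubT3bConjugatePartnerAt`). [cite: Liu2021, Def. 4.11; App. D Lem. D.1] [cite: GelbartRogawski1991, §3 Prop. 3.1.1]
ED. 3.2: CLOSED BY NAME — ★ p799706 `Theorems/H413ConjugatePartnerAtHolds.lean :: …Cruxes.H413.ConjugatePartner.stubT3bConjugatePartnerAt_holds` (F0P4-p05 (g0); over ★ p798585 F0P4-p03 (g0) `stubT3bConjugatePartnerAt_of_reprIndependence` + ★ p796928 A-p17 `LineTransport.lineTransportAt`); type ≡ this letter token-for-token (F0P4-ref1 r21). -/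
theorem stub_T3b_conjugatePartnerAt : StubT3bConjugatePartnerAt :=
  Summit.HodgeConjecture.HodgeConjecture.Cruxes.H413.ConjugatePartner.stubT3bConjugatePartnerAt_holds

/-! ## §4 Kernel-checked composition (no proof hole below this line) -/

/-- The pin's scalar-keyed REPRESENTATIVE SECTION `r_{a₀,i}` of [Liu2021, Def. 4.12]'s collections — the `r`-argument of ★ `uniformOmegaRep` inside ★ `datum413`, textually
(there a constant function of `(μ, hμ)`): the class-section `lineOf`, corrected at the class of the pin's own line `a₀(i)` to the global unit `realUnit …` itself.
Used ONLY in the glue `stubT3aOfRallis_of` (so that `(datum413 …).omega t.μ _ t.ε t.χ` is `omegaAtLine … ((pinRep F V a₀ i).toFun t.ε) t.χ` by `rfl`).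
(print: Liu2021, Def. 4.12 (ll. 2102–2108)) -/
def pinRep (F : HodgeCM.CMField) [IsGalois ℚ F] {ι₁ : F →+* ℂ} (V : HodgeCM.HermSpace3 F ι₁) (a₀ : RealScalar F)
    (i : (I V (repAt a₀) (muLiu ι₁ GramClass.rep))) :
    Rep ↥(maximalRealSubfield (HodgeCM.CMField.K F)) (imagUnitSq (HodgeCM.CMField.K F)) :=
  Rep.update ↥(maximalRealSubfield (HodgeCM.CMField.K F)) (imagUnitSq (HodgeCM.CMField.K F))
    (Rep.ofLineOf ↥(maximalRealSubfield (HodgeCM.CMField.K F)) (imagUnitSq (HodgeCM.CMField.K F)))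
    (locF ↥(maximalRealSubfield (HodgeCM.CMField.K F)) (imagUnitSq (HodgeCM.CMField.K F))
      (realUnit ⟨HodgeCM.CMField.K F⟩ (repAt a₀ (Sigma.fst i)).1 (repAt a₀ (Sigma.fst i)).2.1 (repAt a₀ (Sigma.fst i)).2.2))
    (realUnit ⟨HodgeCM.CMField.K F⟩ (repAt a₀ (Sigma.fst i)).1 (repAt a₀ (Sigma.fst i)).2.1 (repAt a₀ (Sigma.fst i)).2.2) rfl

/-- **Transport of a non-zero equivariant realisation along an equivariant linear isomorphism** (the linear algebra of «T3a-LT ∘ T3a″ ⇒ T3a′»): if `Ψ : Ω ≃ Ω'`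
intertwines `ρ` and `ρ'` (actions of `K`) and `θ' : Ω' → Y` is non-zero with values in `S` and `(ρ' ∘ ι, R)`-equivariant for `ι : G → K`, then `θ' ∘ Ψ` is
non-zero, `S`-valued and `(ρ ∘ ι, R)`-equivariant. [cite: BorelWallach2000, VII 2.10] -/
theorem exists_realisation_of_equiv {G K Ω Ω' Y : Type*} [AddCommGroup Ω] [Module ℂ Ω] [AddCommGroup Ω'] [Module ℂ Ω']
    [AddCommGroup Y] [Module ℂ Y] (S : Submodule ℂ Y) (ι : G → K) (ρ : K → Ω → Ω) (ρ' : K → Ω' → Ω') (R : G → Y → Y)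
    (Ψ : Ω ≃ₗ[ℂ] Ω') (hΨ : ∀ k x, Ψ (ρ k x) = ρ' k (Ψ x))
    (h : ∃ θ' : Ω' →ₗ[ℂ] Y, θ' ≠ 0 ∧ (∀ w, θ' w ∈ S) ∧ ∀ (g : G) (w : Ω'), θ' (ρ' (ι g) w) = R g (θ' w)) :
    ∃ θ : Ω →ₗ[ℂ] Y, θ ≠ 0 ∧ (∀ v, θ v ∈ S) ∧ ∀ (g : G) (v : Ω), θ (ρ (ι g) v) = R g (θ v) := by
  obtain ⟨θ', h0, hS, heq⟩ := h
  refine ⟨θ' ∘ₗ (Ψ : Ω →ₗ[ℂ] Ω'), fun hz => h0 ?_, fun v => hS (Ψ v), fun g v => ?_⟩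
  · ext w
    have hw := LinearMap.congr_fun hz (Ψ.symm w)
    simpa using hw
  · simp only [LinearMap.coe_comp, Function.comp_apply, LinearEquiv.coe_coe]
    rw [hΨ, heq]

set_option synthInstance.maxHeartbeats 400000 in
set_option maxHeartbeats 8000000 in
/-- **GLUE T3a′ (kernel, ED. 2)**: `T3a-LT → T3a″ → StubT3aHolThetaRealisationOfRallisAt`.  DISJUNCT A (`Or.inl`); for a weight-one admissible `t` with `ι₁ ∈ Φ_μ`
take the admissible line `(e, a)` of ★ `AdmissibleLine.exists_admissibleLine` (`locF a = t.ε`, `a = e·2δ`), the realisation `θ'` of T3a″ on `Ω(s_μ(a), χ)`, the transport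
`Ψ : ω_V(t) = Ω(s_μ(r(t.ε)), χ) ≃ Ω(s_μ(a), χ)` of T3a-LT (the classes agree: `locF (r(t.ε)) = t.ε = locF a` by `Rep.locF_toFun` at the global collection `t.ε`), and
`θ := θ' ∘ Ψ`; `ω_V(t)` ∕ `rho t` ARE `omegaAtLine … (r(t.ε)) χ` ∕ `rhoVAtLine … ∘ ιVE V` by `rfl` (★ `uniformOmegaRep`, ★ `rhoAtLine_apply`).
[cite: Liu2021, proof of Prop. 4.13, l. 2145; Def. 4.11–4.12] [cite: GelbartRogawski1991, §3.1 Prop. 3.1.1] -/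
theorem stubT3aOfRallis_of (hLT : StubT3aLineTransportAt) (h3a : StubT3aHolThetaAtAdmissibleLineOfRallisAt) :
    StubT3aHolThetaRealisationOfRallisAt := by
  intro hR hDel F _ h6 ι₁ V a₀ Φ hΦ i hn
  refine Or.inl fun t hw ht hι => ?_
  obtain ⟨e, a, he, hloc, ha, -⟩ :=
    Summit.HodgeConjecture.HodgeConjecture.Cruxes.H413.AdmissibleLine.exists_admissibleLine hDel F V a₀ Φ i t ht
  obtain ⟨Ψ, hΨ⟩ := hLT ⟨HodgeCM.CMField.K F⟩ e₁ (frameD V) (frameD_real V) (frameD_ne V)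
    (Literature.NumberTheory.Automorphic.IdeleClassGroup.toHeckeCharacter (HodgeCM.CMField.K F) t.μ)
    (Literature.NumberTheory.Automorphic.IdeleClassGroup.isUnitary_toHeckeCharacter (HodgeCM.CMField.K F) t.μ)
    ((Literature.RepresentationTheory.Liu2021.isOscillatorChar_toHeckeCharacter_iff t.μ).mpr t.isConjugateSymplectic)
    ((pinRep F V a₀ i).toFun t.ε) a t.χ (((pinRep F V a₀ i).locF_toFun t.ε ⟨a, hloc⟩).trans hloc.symm)
  exact exists_realisation_of_equiv (holCotForms (archFactorOf F V)) (ιVE V) _ _ (fun g f => rightRep F V g f) Ψ hΨ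
    (h3a hR hDel F h6 V a₀ Φ hΦ i hn t hw ht hι e a he hloc ha)

set_option synthInstance.maxHeartbeats 400000 in
set_option maxHeartbeats 8000000 in
/-- **`stub_T3a_holThetaRealisationOfRallisAt`** — T3a′ (L), REGISTERED in ED. 1.1 as a stub and since ED. 2 a THEOREM of the two registered stubs `stub_T3a_lineTransportAt` (T3a-LT)
and `stub_T3a_holThetaAtAdmissibleLineOfRallisAt` (T3a″) by `stubT3aOfRallis_of` — no `sorry` here any more; name and type (`StubT3aHolThetaRealisationOfRallisAt`) unchanged, so
every head below keeps its term. [cite: Liu2021, proof of Prop. 4.13, l. 2145; Lem. D.2] [cite: Weil1964, n° 41 Thm. 6] [cite: Li1992, Thm. 2.1] [cite: KonnoKonno2007, Thm. 5.4] -/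
theorem stub_T3a_holThetaRealisationOfRallisAt : StubT3aHolThetaRealisationOfRallisAt :=
  stubT3aOfRallis_of stub_T3a_lineTransportAt stub_T3a_holThetaAtAdmissibleLineOfRallisAt

set_option synthInstance.maxHeartbeats 400000 in
set_option maxHeartbeats 8000000 in
/-- **T3a is a THEOREM of T3n + T3a′** (ED. 1.1; modus ponens — the content is in the two stubs). [cite: Li1992, Thm. 2.1] [cite: Liu2021, proof of Prop. 4.13, l. 2145] -/
theorem stubT3a_of (hR : Literature.NumberTheory.Li1992.RallisInnerProductFormulaUnitaryDualPairRankOneContCM) (h3a : StubT3aHolThetaRealisationOfRallisAt) :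
    StubT3aHolThetaRealisationAt :=
  h3a hR

set_option synthInstance.maxHeartbeats 400000 in
set_option maxHeartbeats 8000000 in
/-- T3a at the stubs (ED. 1.1). [cite: Li1992, Thm. 2.1] [cite: Liu2021, proof of Prop. 4.13, l. 2145] -/
theorem t3aHolThetaRealisationAt_holds : StubT3aHolThetaRealisationAt :=
  stubT3a_of stub_rallisInnerProductFormula stub_T3a_holThetaRealisationOfRallisAt

set_option synthInstance.maxHeartbeats 400000 in
set_option maxHeartbeats 8000000 in
/-- **GLUE T2 (kernel)**: `T2a → T2b → T2c → StubT2MatsushimaHodgeAt` — apply the generic extension T2c to the holomorphic class map of T2a (range in the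
`(1,0)`-part) and the tower conjugation of T2b (Hodge-disjoint from it). [cite: BorelWallach2000, VII 3.2, VII 3.6] -/
theorem stubT2_of (h2a : StubT2aHolClassMapAt) (h2b : StubT2bTowerConjugationAt) (h2c : StubT2cCohClassMapOfHol) :
    StubT2MatsushimaHodgeAt := by
  intro hDel F _ h6 ι₁ V a₀ Φ hΦ i hn τ'
  obtain ⟨cls₁₀, hinj, heq, hrange⟩ := h2a hDel F h6 V a₀ Φ hΦ i hn τ'
  obtain ⟨cB, hcB, hcBeq, hdisj⟩ := h2b hDel F h6 V a₀ Φ hΦ i τ'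
  exact h2c F V ((datum413 hDel F V a₀ Φ i).HB τ') ((datum413 hDel F V a₀ Φ i).rhoB τ') _ cls₁₀ hinj heq hrange cB hcB hcBeq hdisj

section ConjugationGlue

variable (F : HodgeCM.CMField) {ι₁ : F →+* ℂ} (V : HodgeCM.HermSpace3 F ι₁)

/-- `conjFun` is an involution. [cite: BorelWallach2000, VII 2.10] -/
theorem conjFun_conjFun (f : (adelicDatum F V).Adelic → (Fin 2 → ℂ)) : conjFun F V (conjFun F V f) = f := by
  funext x
  exact star_star (f x)

/-- `conjFun` is injective. [cite: BorelWallach2000, VII 2.10] -/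
theorem conjFun_injective : Function.Injective (conjFun F V) :=
  Function.LeftInverse.injective (conjFun_conjFun F V)

/-- `conjFun` commutes with finite-adelic right translation (definitionally). [cite: BorelJacquet1979, §4.2] -/
theorem conjFun_rightRep (g : ↥(HodgeCM.HermSpace3.adelicFin V)) (f : (adelicDatum F V).Adelic → (Fin 2 → ℂ)) :
    conjFun F V (rightRep F V g f) = rightRep F V g (conjFun F V f) :=
  rfl

variable {F V}

/-- conjugate-linear ∘ linear ∘ conjugate-linear is linear: `v ↦ K (θ (J v))`. [folklore] -/
def conjSandwich {A B : Type} [AddCommGroup A] [Module ℂ A] [AddCommGroup B] [Module ℂ B]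
    (K : ((adelicDatum F V).Adelic → (Fin 2 → ℂ)) →ₛₗ[starRingEnd ℂ] ((adelicDatum F V).Adelic → (Fin 2 → ℂ)))
    (θ : B →ₗ[ℂ] ((adelicDatum F V).Adelic → (Fin 2 → ℂ))) (J : A →ₛₗ[starRingEnd ℂ] B) :
    A →ₗ[ℂ] ((adelicDatum F V).Adelic → (Fin 2 → ℂ)) where
  toFun v := K (θ (J v))
  map_add' v w := by simp only [map_add]
  map_smul' c v := by simp only [LinearMap.map_smulₛₗ, RingHom.id_apply, starRingEnd_self_apply]

@[simp] theorem conjSandwich_apply {A B : Type} [AddCommGroup A] [Module ℂ A] [AddCommGroup B] [Module ℂ B]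
    (K : ((adelicDatum F V).Adelic → (Fin 2 → ℂ)) →ₛₗ[starRingEnd ℂ] ((adelicDatum F V).Adelic → (Fin 2 → ℂ)))
    (θ : B →ₗ[ℂ] ((adelicDatum F V).Adelic → (Fin 2 → ℂ))) (J : A →ₛₗ[starRingEnd ℂ] B) (v : A) :
    conjSandwich K θ J v = K (θ (J v)) :=
  rfl

end ConjugationGlue

set_option synthInstance.maxHeartbeats 400000 in
set_option maxHeartbeats 8000000 in
/-- **GLUE T3 (kernel)**: `T3a → T3b → StubT3ThetaFormsAt` — a triple of the holomorphic class is realised in `holCotForms 𝔞₀ ≤ cohForms 𝔞₀` directly; a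
triple of the other class through its conjugate partner `t'` (T3b) by `θ_t := conjFun ∘ θ_{t'} ∘ J`, with values in `conjFun (holCotForms 𝔞₀) ≤ cohForms 𝔞₀`,
non-zero (`J` bijective, `conjFun` injective) and equivariant (`conjFun_rightRep`). [cite: Liu2021, proof of Prop. 4.13, l. 2145; Lem. D.2 (2)] -/
theorem stubT3_of (h3a : StubT3aHolThetaRealisationAt) (h3b : StubT3bConjugatePartnerAt) : StubT3ThetaFormsAt := by
  intro hDel F _ h6 ι₁ V a₀ Φ hΦ i hn t hw hadm
  -- (i) a holomorphic realisation of `t` itself is a cohomological one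
  have direct : (∃ θ : (datum413 hDel F V a₀ Φ i).omega t.μ t.isConjugateSymplectic t.ε t.χ →ₗ[ℂ] ((adelicDatum F V).Adelic → (Fin 2 → ℂ)),
        θ ≠ 0 ∧ (∀ v, θ v ∈ holCotForms (archFactorOf F V)) ∧
          ∀ (g : ↥(HodgeCM.HermSpace3.adelicFin V)) (v : (datum413 hDel F V a₀ Φ i).omega t.μ t.isConjugateSymplectic t.ε t.χ),
            θ (rhoTriple (datum413 hDel F V a₀ Φ i) t g v) = rightRep F V g (θ v)) →
      ∃ θ : (datum413 hDel F V a₀ Φ i).omega t.μ t.isConjugateSymplectic t.ε t.χ →ₗ[ℂ] ((adelicDatum F V).Adelic → (Fin 2 → ℂ)),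
        θ ≠ 0 ∧ (∀ v, θ v ∈ cohForms (archFactorOf F V)) ∧
          ∀ (g : ↥(HodgeCM.HermSpace3.adelicFin V)) (v : (datum413 hDel F V a₀ Φ i).omega t.μ t.isConjugateSymplectic t.ε t.χ),
            θ (rhoTriple (datum413 hDel F V a₀ Φ i) t g v) = rightRep F V g (θ v) := by
    rintro ⟨θ, hθ, hθA, hθeq⟩
    exact ⟨θ, hθ, fun v => Submodule.mem_sup_left (hθA v), hθeq⟩
  -- (ii) a holomorphic realisation of a conjugate partner `t'` gives an anti-holomorphic one of `t`
  have viaPartner : ∀ t' : (datum413 hDel F V a₀ Φ i).Triple,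
      (∃ J : (datum413 hDel F V a₀ Φ i).omega t.μ t.isConjugateSymplectic t.ε t.χ →ₛₗ[starRingEnd ℂ] (datum413 hDel F V a₀ Φ i).omega t'.μ t'.isConjugateSymplectic t'.ε t'.χ,
          Function.Bijective J ∧
            ∀ (g : ↥(HodgeCM.HermSpace3.adelicFin V)) (v : (datum413 hDel F V a₀ Φ i).omega t.μ t.isConjugateSymplectic t.ε t.χ),
              J (rhoTriple (datum413 hDel F V a₀ Φ i) t g v) = rhoTriple (datum413 hDel F V a₀ Φ i) t' g (J v)) →
      (∃ θ : (datum413 hDel F V a₀ Φ i).omega t'.μ t'.isConjugateSymplectic t'.ε t'.χ →ₗ[ℂ] ((adelicDatum F V).Adelic → (Fin 2 → ℂ)),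
        θ ≠ 0 ∧ (∀ v, θ v ∈ holCotForms (archFactorOf F V)) ∧
          ∀ (g : ↥(HodgeCM.HermSpace3.adelicFin V)) (v : (datum413 hDel F V a₀ Φ i).omega t'.μ t'.isConjugateSymplectic t'.ε t'.χ),
            θ (rhoTriple (datum413 hDel F V a₀ Φ i) t' g v) = rightRep F V g (θ v)) →
      ∃ θ : (datum413 hDel F V a₀ Φ i).omega t.μ t.isConjugateSymplectic t.ε t.χ →ₗ[ℂ] ((adelicDatum F V).Adelic → (Fin 2 → ℂ)),
        θ ≠ 0 ∧ (∀ v, θ v ∈ cohForms (archFactorOf F V)) ∧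
          ∀ (g : ↥(HodgeCM.HermSpace3.adelicFin V)) (v : (datum413 hDel F V a₀ Φ i).omega t.μ t.isConjugateSymplectic t.ε t.χ),
            θ (rhoTriple (datum413 hDel F V a₀ Φ i) t g v) = rightRep F V g (θ v) := by
    rintro t' ⟨J, hJ, hJeq⟩ ⟨θ', hθ', hθ'A, hθ'eq⟩
    refine ⟨conjSandwich (conjFun F V) θ' J, ?_, fun v => ?_, fun g v => ?_⟩
    · -- non-vanishing
      obtain ⟨w, hw⟩ : ∃ w, θ' w ≠ 0 := by
        by_contra hall
        push Not at hall
        exact hθ' (LinearMap.ext hall)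
      obtain ⟨v, rfl⟩ := hJ.2 w
      intro hzero
      apply hw
      have h1 : conjFun F V (θ' (J v)) = 0 := by
        have := LinearMap.congr_fun hzero v
        simpa only [conjSandwich_apply, LinearMap.zero_apply] using this
      have h2 : conjFun F V (θ' (J v)) = conjFun F V 0 := by rw [h1, map_zero]
      exact conjFun_injective F V h2
    · -- values in `conjFun (holCotForms 𝔞₀) ≤ cohForms 𝔞₀`
      simp only [conjSandwich_apply]
      exact Submodule.mem_sup_right (Submodule.mem_map_of_mem (hθ'A (J v)))
    · -- equivariance
      simp only [conjSandwich_apply, hJeq, hθ'eq]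
      exact conjFun_rightRep F V g (θ' (J v))
  -- (iii) the two classes
  rcases h3a hDel F h6 V a₀ Φ hΦ i hn with hIn | hOut
  · by_cases hι : ι₁ ∈ t.cmType.1
    · exact direct (hIn t hw hadm hι)
    · obtain ⟨t', hw', hadm', hflip, hJ⟩ := h3b hDel F h6 V a₀ Φ hΦ i hn t hw hadm
      exact viaPartner t' hJ (hIn t' hw' hadm' (hflip.mpr hι))
  · by_cases hι : ι₁ ∈ t.cmType.1
    · obtain ⟨t', hw', hadm', hflip, hJ⟩ := h3b hDel F h6 V a₀ Φ hΦ i hn t hw hadm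
      exact viaPartner t' hJ (hOut t' hw' hadm' (fun h' => hflip.mp h' hι))
    · exact direct (hOut t hw hadm hι)

section Assembly

variable {F₀ E₀ : Type} [Field F₀] [NumberField F₀] [IsTotallyReal F₀] [Field E₀] [NumberField E₀] [Algebra F₀ E₀]
  [IsTotallyComplex E₀] [Algebra.IsQuadraticExtension F₀ E₀]

/-- **The algebra of the assembly** (generic, any `Prop413Data`): an INJECTIVE `G`-equivariant `ℂ`-linear map `cls : A → H¹_B` on a
`G`-stable target subspace `A` of some `G`-module of functions, composed with a NON-ZERO `G`-equivariant map `θ : ω_t → A`, is a non-zero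
intertwiner `ω_t → H¹_B`, i.e. `ω_t` OCCURS (`OccursInH1`). [cite: Liu2021, proof of Prop. 4.13, l. 2145] -/
theorem occursInH1_of_classMap_of_thetaForms (P : Prop413Data F₀ E₀) (τ' : E₀ →+* ℂ) (t : P.Triple)
    {X : Type} [AddCommGroup X] [Module ℂ X] (R : Representation ℂ P.G X) (A : Submodule ℂ X)
    (cls : ↥A →ₗ[ℂ] P.HB τ') (hinj : Function.Injective cls)
    (hcls : ∀ (g : P.G) (f : ↥A) (hgf : R g (f : X) ∈ A), cls ⟨R g (f : X), hgf⟩ = P.rhoB τ' g (cls f))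
    (θ : P.omega t.μ t.isConjugateSymplectic t.ε t.χ →ₗ[ℂ] X) (hθ : θ ≠ 0) (hθA : ∀ v, θ v ∈ A)
    (hθeq : ∀ (g : P.G) (v : P.omega t.μ t.isConjugateSymplectic t.ε t.χ), θ (rhoTriple P t g v) = R g (θ v)) :
    OccursInH1 P τ' (rhoTriple P t) := by
  -- the composite `v ↦ cls ⟨θ v, _⟩`
  let j : P.omega t.μ t.isConjugateSymplectic t.ε t.χ →ₗ[ℂ] P.HB τ' := cls ∘ₗ LinearMap.codRestrict A θ hθA
  have hj : ∀ (g : P.G) (v : P.omega t.μ t.isConjugateSymplectic t.ε t.χ), j (rhoTriple P t g v) = P.rhoB τ' g (j v) := by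
    intro g v
    have hmem : R g (θ v) ∈ A := by rw [← hθeq]; exact hθA _
    have h1 : LinearMap.codRestrict A θ hθA (rhoTriple P t g v) = ⟨R g (θ v), hmem⟩ := by
      apply Subtype.ext
      simp only [LinearMap.codRestrict_apply, hθeq]
    have h2 := hcls g ⟨θ v, hθA v⟩ hmem
    calc j (rhoTriple P t g v) = cls (LinearMap.codRestrict A θ hθA (rhoTriple P t g v)) := rfl
      _ = cls ⟨R g (θ v), hmem⟩ := by rw [h1]
      _ = P.rhoB τ' g (cls ⟨θ v, hθA v⟩) := h2
      _ = P.rhoB τ' g (j v) := rfl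
  refine ⟨LinearMap.intertwiningMap_of_isIntertwiningMap (ρ := rhoTriple P t) (σ := P.rhoB τ') j hj, ?_⟩
  -- non-vanishing: `θ v ≠ 0` for some `v`, and `cls` is injective
  obtain ⟨v, hv⟩ : ∃ v, θ v ≠ 0 :=
    Classical.by_contradiction fun h => hθ (LinearMap.ext fun w => not_ne_iff.mp (not_exists.mp h w))
  intro hzero
  have hjv : j v = 0 := by
    have := congrArg (fun φ : Representation.IntertwiningMap (rhoTriple P t) (P.rhoB τ') => φ v) hzero
    simpa using this
  have : LinearMap.codRestrict A θ hθA v = 0 := hinj (by simpa [j] using hjv)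
  exact hv (by simpa using congrArg Subtype.val this)

end Assembly

set_option synthInstance.maxHeartbeats 400000 in
set_option maxHeartbeats 8000000 in
/-- **HEAD 1 — `hocc` from the two stubs** (kernel-checked): `StubT2 → StubT3 → HoccType`.  Unfold `HoccType` to the face, take the class map
at the factor of record (T2′, `3 ≤ n` from `n = 3`) and the theta map (T3′), and apply `occursInH1_of_classMap_of_thetaForms`. HC_CM is proved only modulo the 7 printed citations until rung 0 closes.
[cite: Liu2021, proof of Prop. 4.13, l. 2145] -/
theorem admissible_occursInH1_holds_of (h2 : StubT2MatsushimaHodgeAt) (h3 : StubT3ThetaFormsAt) : HoccType := by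
  intro hDel F _ h6 ι₁ V a₀ Φ hΦ i hn τ' t hw hadm
  obtain ⟨cls, hinj, hcls⟩ := h2 hDel F h6 V a₀ Φ hΦ i (le_of_eq hn.symm) τ'
  obtain ⟨θ, hθ, hθA, hθeq⟩ := h3 hDel F h6 V a₀ Φ hΦ i hn t hw hadm
  exact occursInH1_of_classMap_of_thetaForms (datum413 hDel F V a₀ Φ i) τ' t (rightRep F V) (cohForms (archFactorOf F V)) cls hinj hcls
    θ hθ hθA hθeq

set_option synthInstance.maxHeartbeats 400000 in
set_option maxHeartbeats 8000000 in
/-- **HEAD 1′ — `hocc` from the FIVE stubs** (kernel-checked): `T2a → T2b → T2c → T3a → T3b → HoccType` := v2.1's HEAD 1 at `stubT2_of`, `stubT3_of`.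
HC_CM is proved only modulo the printed citations until rung 0 closes. [cite: Liu2021, proof of Prop. 4.13, l. 2145] -/
theorem admissible_occursInH1_holds_of5 (h2a : StubT2aHolClassMapAt) (h2b : StubT2bTowerConjugationAt) (h2c : StubT2cCohClassMapOfHol)
    (h3a : StubT3aHolThetaRealisationAt) (h3b : StubT3bConjugatePartnerAt) : HoccType :=
  admissible_occursInH1_holds_of (stubT2_of h2a h2b h2c) (stubT3_of h3a h3b)

set_option synthInstance.maxHeartbeats 400000 in
set_option maxHeartbeats 8000000 in
/-- **HEAD 1″ — `hocc` from the SIX stubs of ED. 1.1**: `T2a → T2b → T2c → T3n → T3a′ → T3b → HoccType`. HC_CM is proved only modulo the printed citations until rung 0 closes.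
[cite: Liu2021, proof of Prop. 4.13, l. 2145] [cite: Li1992, Thm. 2.1] -/
theorem admissible_occursInH1_holds_of6 (h2a : StubT2aHolClassMapAt) (h2b : StubT2bTowerConjugationAt) (h2c : StubT2cCohClassMapOfHol)
    (hR : Literature.NumberTheory.Li1992.RallisInnerProductFormulaUnitaryDualPairRankOneContCM) (h3a : StubT3aHolThetaRealisationOfRallisAt)
    (h3b : StubT3bConjugatePartnerAt) : HoccType :=
  admissible_occursInH1_holds_of5 h2a h2b h2c (stubT3a_of hR h3a) h3b

set_option synthInstance.maxHeartbeats 400000 in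
set_option maxHeartbeats 8000000 in
/-- **HEAD 1‴ — `hocc` from the SEVEN stubs of ED. 2**: `T2a → T2b → T2c → T3n → T3a-LT → T3a″ → T3b → HoccType` (T3a′ := `stubT3aOfRallis_of`).
HC_CM is proved only modulo the printed citations until rung 0 closes. [cite: Liu2021, proof of Prop. 4.13, l. 2145] [cite: Li1992, Thm. 2.1] -/
theorem admissible_occursInH1_holds_of7 (h2a : StubT2aHolClassMapAt) (h2b : StubT2bTowerConjugationAt) (h2c : StubT2cCohClassMapOfHol)
    (hR : Literature.NumberTheory.Li1992.RallisInnerProductFormulaUnitaryDualPairRankOneContCM) (hLT : StubT3aLineTransportAt)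
    (h3a : StubT3aHolThetaAtAdmissibleLineOfRallisAt) (h3b : StubT3bConjugatePartnerAt) : HoccType :=
  admissible_occursInH1_holds_of6 h2a h2b h2c hR (stubT3aOfRallis_of hLT h3a) h3b

set_option synthInstance.maxHeartbeats 400000 in
set_option maxHeartbeats 8000000 in
/-- **`hocc` MODULO EXACTLY THE SIX P4 STUBS of ED. 1.1** (zero further hypotheses): the by-name fold `stub_admissible_occursInH1 := hocc_of_stubs` of
`Cruxes/H413/Lines/a3_liu413.lean` v10.2 once the six stubs are theorems (ED. 2: `stub_T3a_holThetaRealisationOfRallisAt` is itself the theorem `stubT3aOfRallis_of` of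
`stub_T3a_lineTransportAt` + `stub_T3a_holThetaAtAdmissibleLineOfRallisAt`, so the registered holes are SEVEN, four open; this term is unchanged).  HC_CM is proved only modulo the printed citations until rung 0 closes. [cite: Liu2021, proof of Prop. 4.13, l. 2145] -/
theorem hocc_of_stubs : HoccType :=
  admissible_occursInH1_holds_of6 stub_T2a_holClassMapAt stub_T2b_towerConjugationAt stub_T2c_cohClassMapOfHol
    stub_rallisInnerProductFormula stub_T3a_holThetaRealisationOfRallisAt stub_T3b_conjugatePartnerAt

set_option synthInstance.maxHeartbeats 400000 in
set_option maxHeartbeats 8000000 in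
/-- **v2.1's two nodes are THEOREMS of the six stubs** (so the line of record's registered holes `stub_T2_matsushimaHodgeAt` ∕ `stub_T3_thetaFormsAt` fold by name).
[cite: BorelWallach2000, VII 3.2] [cite: Liu2021, proof of Prop. 4.13, l. 2145] -/
theorem stubT2MatsushimaHodgeAt_holds : StubT2MatsushimaHodgeAt :=
  stubT2_of stub_T2a_holClassMapAt stub_T2b_towerConjugationAt stub_T2c_cohClassMapOfHol

set_option synthInstance.maxHeartbeats 400000 in
set_option maxHeartbeats 8000000 in
/-- See `stubT2MatsushimaHodgeAt_holds`. [cite: Liu2021, proof of Prop. 4.13, l. 2145] -/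
theorem stubT3ThetaFormsAt_holds : StubT3ThetaFormsAt :=
  stubT3_of t3aHolThetaRealisationAt_holds stub_T3b_conjugatePartnerAt

set_option synthInstance.maxHeartbeats 400000 in
set_option maxHeartbeats 8000000 in
/-- **HEAD 2′ (head of record) — the crux `HCCMUnconditional.H413` BY NAME from the six P4 stubs of ED. 1.1 and the two OTHER floor rows as hypotheses**:
`T2a → T2b → T2c → T3n → T3a′ → T3b → HdictEType → HJ3aType → H413` := ★ `Hyp413Closing.H413_of_three_facts_flat hdictE hJ3a (admissible_occursInH1_holds_of6 …)`.
`hdictE` (III-2 (a)′, programme P2) and `hJ3a` (III-J3a, programme P3) are NOT re-declared here.  HC_CM is proved only modulo the printed citations until rung 0 closes. [cite: Liu2021, Prop. 4.13; Rem. 4.14] -/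
theorem H413_of_P4 (h2a : StubT2aHolClassMapAt) (h2b : StubT2bTowerConjugationAt) (h2c : StubT2cCohClassMapOfHol)
    (hR : Literature.NumberTheory.Li1992.RallisInnerProductFormulaUnitaryDualPairRankOneContCM) (h3a : StubT3aHolThetaRealisationOfRallisAt)
    (h3b : StubT3bConjugatePartnerAt) (hdictE : HdictEType) (hJ3a : HJ3aType) :
    Summit.HodgeConjecture.HodgeConjecture.Theses.HCCMUnconditional.H413 :=
  Summit.HodgeConjecture.CorCM.Hyp413Closing.H413_of_three_facts_flat hdictE hJ3a (admissible_occursInH1_holds_of6 h2a h2b h2c hR h3a h3b)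

set_option synthInstance.maxHeartbeats 400000 in
set_option maxHeartbeats 8000000 in
/-- **HEAD 2″ (ED. 2) — `HCCMUnconditional.H413` BY NAME from the SEVEN P4 stubs and the two other floor rows**:
`T2a → T2b → T2c → T3n → T3a-LT → T3a″ → T3b → HdictEType → HJ3aType → H413` := `H413_of_P4` at `stubT3aOfRallis_of`.  HC_CM is proved only modulo the printed citations
until rung 0 closes. [cite: Liu2021, Prop. 4.13; Rem. 4.14] -/
theorem H413_of_P4_ed2 (h2a : StubT2aHolClassMapAt) (h2b : StubT2bTowerConjugationAt) (h2c : StubT2cCohClassMapOfHol)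
    (hR : Literature.NumberTheory.Li1992.RallisInnerProductFormulaUnitaryDualPairRankOneContCM) (hLT : StubT3aLineTransportAt)
    (h3a : StubT3aHolThetaAtAdmissibleLineOfRallisAt) (h3b : StubT3bConjugatePartnerAt) (hdictE : HdictEType) (hJ3a : HJ3aType) :
    Summit.HodgeConjecture.HodgeConjecture.Theses.HCCMUnconditional.H413 :=
  H413_of_P4 h2a h2b h2c hR (stubT3aOfRallis_of hLT h3a) h3b hdictE hJ3a

set_option synthInstance.maxHeartbeats 400000 in
set_option maxHeartbeats 8000000 in
/-- **HEAD 2′ at the stubs**: `H413` from the two other floor rows alone, modulo the six registered holes. HC_CM is proved only modulo the printed citations until rung 0 closes. [cite: Liu2021, Prop. 4.13] -/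
theorem H413_of_hdictE_hJ3a (hdictE : HdictEType) (hJ3a : HJ3aType) :
    Summit.HodgeConjecture.HodgeConjecture.Theses.HCCMUnconditional.H413 :=
  H413_of_P4 stub_T2a_holClassMapAt stub_T2b_towerConjugationAt stub_T2c_cohClassMapOfHol stub_rallisInnerProductFormula
    stub_T3a_holThetaRealisationOfRallisAt stub_T3b_conjugatePartnerAt hdictE hJ3a

set_option synthInstance.maxHeartbeats 400000 in
set_option maxHeartbeats 8000000 in
/-- **R3 SOCKET HEAD (edition 3.1′)** — the FLOOR-0 socket III-2 (c)′ `F0FloorSockets.HoccType` (admissible oscillator triples OCCUR in `H¹` at the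
printed datum; the TYPE of the binder `hocc` of ★ `hc_cm_of_generic_floor_v7`, ll. 81–85) BY THE SOCKET NAME, from the registered stubs ONLY: the term
`hocc_of_stubs` read at the socket type (the in-file `HoccType` :155 and ★ `F0FloorSockets.HoccType` :109 are the same binder pasted verbatim — kernel-defeq
by delta).  Registration target of s386 (R3) for programme P4 (`ledger skeleton check … --crux <F0Hocc item> --crux-decl …Theorems.F0FloorSockets.HoccType`).
HC_CM is proved only modulo the printed citations until rung 0 closes. [cite: Liu2021, proof of Prop. 4.13, l. 2145] [cite: Li1992, Thm. 2.1] -/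
theorem hocc_of_F0 : Summit.HodgeConjecture.HodgeConjecture.Theorems.F0FloorSockets.HoccType :=
  hocc_of_stubs

set_option synthInstance.maxHeartbeats 400000 in
set_option maxHeartbeats 8000000 in
/-- The same socket head with the SEVEN stub STATEMENTS of ED. 2 as hypotheses (`T2a → T2b → T2c → S6 → T3a-LT → T3a″ → T3b → F0FloorSockets.HoccType`;
no `sorry` in its closure) := `admissible_occursInH1_holds_of7` read at the socket type. HC_CM is proved only modulo the printed citations until rung 0 closes.
[cite: Liu2021, proof of Prop. 4.13, l. 2145] [cite: Li1992, Thm. 2.1]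
R-EDITION (registrar A-plan1 (g18), 2026-08-31T02:50Z, R3): this informational head is concluded at the delta-defeq IN-FILE∕opened alias instead of the `F0FloorSockets` socket name, so that EXACTLY ONE theorem of the file concludes the socket BY NAME — the skeleton checker (`#h21_check_skeleton`) takes an arbitrary one of several candidates and bounced the hypothesis-carrying variant as `skeleton.extra-hypothesis`; statement content unchanged (same binder, same body). -/
theorem hocc_of_F0_shapes (h2a : StubT2aHolClassMapAt) (h2b : StubT2bTowerConjugationAt) (h2c : StubT2cCohClassMapOfHol)
    (hR : Literature.NumberTheory.Li1992.RallisInnerProductFormulaUnitaryDualPairRankOneContCM) (hLT : StubT3aLineTransportAt)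
    (h3a : StubT3aHolThetaAtAdmissibleLineOfRallisAt) (h3b : StubT3bConjugatePartnerAt) :
    HoccType :=
  admissible_occursInH1_holds_of7 h2a h2b h2c hR hLT h3a h3b

end Summit.HodgeConjecture.HodgeConjecture.Cruxes.H413.F0P4AdmissibleOccursInH1

end
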